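import Literature.Probability.RandomPlanarGeometry.YangBaxterSAWGeneralDomain
import Literature.Barriers.CriticalPhenomena.PlaquetteWalkYBCurveIdentity

/-!
# Isthmus hole roots: the Yang–Baxter vertex identity away from the root plaquette

Companion of `YangBaxterSAWGeneralDomain.lean` (Glazman–Manolescu's Lemma 2.1 / Duminil-Copin–Smirnov's
Lemma 1 on a general finite plaquette domain `D ⊂ ℤ²` for every OUTER root) and of the barrier
catalogue's `PlaquetteWalkYBIdentity.lean`. There the root mid-edge `a` must lie on the outer boundary
(`OuterRoot`): for a root on the boundary of a HOLE the identity fails (venture lane «pcv-sawmu»,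
HOME/STRUCTURE.md «C-B2 HOLE DATUM»). This file proves WHERE it still holds for the simplest hole roots.

Call the root `a = w.side σ` (inner plaquette `w ∈ D`, the plaquette across `a` not in `D`) an
**isthmus root** if the plaquette `o` across the OPPOSITE side `w.side σ.opp` is an outer exterior
plaquette (`OuterRoot D (w.side σ.opp)`), i.e. `w` is a width-one isthmus between the (possible) hole
behind `a` and the outside. Then (`vertexFunctional_printed_eq_zero_of_isthmus`): for every
`θ ∈ [π/3, 2π/3]` the vertex functional of the printed Yang–Baxter weights with the coefficients
`(1, r(θ), −1, −r(θ))` vanishes at EVERY plaquette `f₀ ∈ D` OTHER THAN `w` — whether or not `a` is an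
outer root. (At `f₀ = w` it fails for genuine hole roots: lane numerics, HOME/code/step0/g12/f4cell/
F4CELL.md remark (iv): 17/17 isthmus hole roots fail at exactly the one plaquette `w`.)

Mechanism (elementary, no winding argument): every walk from `a` makes its first arc inside `w`; a
later arc inside `w` would have to leave through the opposite side into `o ∉ D` and end there. Hence
for end mid-edges `z ∉ {a, w.side σ.opp}` the walks from `a` to `z` in `D` are in weight- and
winding-preserving bijection with the walks to `z` from the three other sides of `w` in `D ∖ {w}`
(`gmObservable_isthmus`), and each of those roots IS an outer root of `D ∖ {w}` (through `w` and `o`),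
so the tree's outer-root theorem `vertexFunctional_printed_eq_zero` applies to each piece; the same three
lines with the tree's `vertexFunctional_ybCurve_eq_zero` (`PlaquetteWalkYBCurveIdentity.lean`) give the
statement on the whole complexified Yang–Baxter curve (`vertexFunctional_ybCurve_eq_zero_of_isthmus`).

References: A. Glazman, I. Manolescu, arXiv:1708.00395, Lemma 2.1 [GlazmanManolescu2019];
H. Duminil-Copin, S. Smirnov, Ann. of Math. 175 (2012), Lemma 1 (simply connected domains, a ∈ ∂Ω)
[DuminilCopinSmirnov2012].

Status in print: the vertex relation is printed only for simply connected domains with the root on the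
boundary — [cite: DuminilCopinSmirnov2012, §2 and proof of Lemma 1 («we used the fact that a is on the
boundary and Ω is simply connected», arXiv p. 4)], [cite: KrachunPanagiotis2026, §2 p. 4 and Remark 2
p. 5 (arXiv:2310.17299)], [cite: Glazman2015WeightedSAW, §3 p. 5 (parallelogram)],
[cite: GlazmanManolescu2019, Lemma 2.1 (arXiv v3 pp. 6–7, Rect_{T,L}(Θ))]; the isthmus-root identity on
domains with holes proved here is not located in print — NEW-IN-WRITING (lit-2 g16, 2026-08-23). It
refines the lane's negative datum «hole-rooted ⇒ false» to «false exactly at the root plaquette» for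
isthmus roots (scope caveat: width-one isthmus only; general hole roots fail at many plaquettes).
Written for the venture lane «pcv-sawmu» (Tier B, seat b-step0).
-/

noncomputable section

open Real

namespace Literature.Barriers.CriticalPhenomena.PlaquetteWalk

open Literature.Probability.RandomPlanarGeometry.SAW.YangBaxter
open Literature.Probability.RandomPlanarGeometry.SAW.YangBaxter.MidEdge

/-! ### The plaquette across a side -/

/-- The plaquette across the side `s` of `w`. [folklore] -/
def nbr (w : Face) (s : Side) : Face :=
  match s with
  | .W => (w.1 - 1, w.2)
  | .E => (w.1 + 1, w.2)
  | .S => (w.1, w.2 - 1)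
  | .N => (w.1, w.2 + 1)

/-- The two plaquettes of the side `s` of `w` are `w` and `nbr w s`. [folklore] -/
private theorem faces_side_eq (w : Face) (s : Side) :
    (w.side s).faces = (nbr w s, w) ∨ (w.side s).faces = (w, nbr w s) := by
  obtain ⟨x, y⟩ := w
  cases s <;> simp [Face.side, MidEdge.faces, nbr]

/-- A plaquette having `w.side s` as a side is `w` or the plaquette across. [folklore] -/
private theorem eq_or_eq_nbr_of_faces {w f : Face} {s : Side}
    (h : f = (w.side s).faces.1 ∨ f = (w.side s).faces.2) : f = w ∨ f = nbr w s := by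
  rcases faces_side_eq w s with e | e <;> rw [e] at h <;> tauto

/-- The plaquette of an arc starting on the side `s` of `w` is `w` or the plaquette across. [folklore] -/
private theorem arcFace_left_cases {w f : Face} {s : Side} {y : MidEdge} (h : arcFace (w.side s, y) = some f) :
    f = w ∨ f = nbr w s :=
  eq_or_eq_nbr_of_faces (MidEdge.commonFace_eq_some h).2.1

/-- The plaquette of an arc ending on the side `s` of `w` is `w` or the plaquette across. [folklore] -/
private theorem arcFace_right_cases {w f : Face} {s : Side} {x : MidEdge} (h : arcFace (x, w.side s) = some f) :
    f = w ∨ f = nbr w s :=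
  eq_or_eq_nbr_of_faces (MidEdge.commonFace_eq_some h).2.2

/-- `w` and the plaquette across a side share a corner. [folklore] -/
private theorem exists_corner_nbr (w : Face) (s : Side) : ∃ q : ℤ × ℤ, IsCornerOf q w ∧ IsCornerOf q (nbr w s) := by
  obtain ⟨x, y⟩ := w
  cases s
  · exact ⟨(x, y), ⟨Or.inl rfl, Or.inl rfl⟩, ⟨Or.inr (by simp [nbr]), Or.inl rfl⟩⟩
  · exact ⟨(x + 1, y), ⟨Or.inr rfl, Or.inl rfl⟩, ⟨Or.inl (by simp [nbr]), Or.inl rfl⟩⟩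
  · exact ⟨(x, y), ⟨Or.inl rfl, Or.inl rfl⟩, ⟨Or.inl rfl, Or.inr (by simp [nbr])⟩⟩
  · exact ⟨(x, y + 1), ⟨Or.inl rfl, Or.inr rfl⟩, ⟨Or.inl rfl, Or.inl (by simp [nbr])⟩⟩

/-- The two sides other than `σ` and its opposite: any three sides avoiding `σ, σ.opp` repeat.
[folklore] -/
private theorem lateral_cases {σ a b c : Side} (ha : a ≠ σ) (ha' : a ≠ σ.opp) (hb : b ≠ σ) (hb' : b ≠ σ.opp)
    (hc : c ≠ σ) (hc' : c ≠ σ.opp) (hbc : b ≠ c) : a = b ∨ a = c := by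
  revert a b c σ; decide

/-! ### Walks from an isthmus root never re-enter the root plaquette -/

section Isthmus

variable {Dl : List Face} {w : Face} {σ : Side} {z : MidEdge}

/-- **The first arc of a walk from the root `w.side σ` lies in `w`** (the plaquette across is not in
the domain). [cite: GlazmanManolescu2019, §2.1 (walks start on the boundary)] -/
theorem arcFace_zero_eq (hh : nbr w σ ∉ dom Dl) (γ : YBWalk (dom Dl) (w.side σ) z) (h0 : 0 < γ.arcs.length) :
    arcFace (γ.nth 0, γ.nth 1) = some w := by
  obtain ⟨f, hfD, hf⟩ := γ.arc_nth h0
  rw [γ.nth_zero] at hf ⊢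
  rcases arcFace_left_cases hf with rfl | rfl
  · exact hf
  · exact absurd hfD hh

/-- **Key combinatorial lemma.** For an isthmus root (`nbr w σ ∉ D`, `nbr w σ.opp ∉ D`), a walk from
`w.side σ` whose end is not the opposite side `w.side σ.opp` has NO arc in `w` after the first one.
[folklore] -/
private theorem arcFace_ne_of_pos (hh : nbr w σ ∉ dom Dl) (ho : nbr w σ.opp ∉ dom Dl) (hz : z ≠ w.side σ.opp)
    (γ : YBWalk (dom Dl) (w.side σ) z) {i : ℕ} (hi1 : 1 ≤ i) (hi : i < γ.arcs.length) :
    arcFace (γ.nth i, γ.nth (i + 1)) ≠ some w := by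
  intro hw
  have h0 := arcFace_zero_eq hh γ (by omega)
  -- an arc in `w` cannot follow the first arc
  have hi2 : 2 ≤ i := by
    by_contra hlt
    have : i = 1 := by omega
    subst this
    exact γ.chain_nth (i := 0) (by omega) (by rw [h0, zero_add, hw])
  obtain ⟨s₁, s₂, hne, h1, h2, -⟩ := exists_sides_of_arcFace hw
  simp only at h1 h2
  -- neither end of the arc is the opposite side
  have opp_next : ∀ j, 1 ≤ j → j ≤ γ.arcs.length → γ.nth j = w.side σ.opp →
      (j = γ.arcs.length ∨ arcFace (γ.nth j, γ.nth (j + 1)) = some w) := by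
    intro j hj1 hj e
    rcases Nat.lt_or_ge j γ.arcs.length with hlt | hge
    · right
      obtain ⟨f, hfD, hf⟩ := γ.arc_nth hlt
      rw [e] at hf ⊢
      rcases arcFace_left_cases hf with rfl | rfl
      · exact hf
      · exact absurd hfD ho
    · left; omega
  have hs₂ : s₂ ≠ σ.opp := by
    intro e; rw [e] at h2
    rcases opp_next (i + 1) (by omega) (by omega) h2.symm with hlen | hw'
    · apply hz; rw [← γ.nth_length, ← hlen, ← h2]
    · exact γ.chain_nth (i := i) (by
        rcases Nat.lt_or_ge (i + 1) γ.arcs.length with hlt | hge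
        · exact hlt
        · exfalso; apply hz; rw [← γ.nth_length, show γ.arcs.length = i + 1 by omega, ← h2]) (by rw [hw, hw'])
  have hs₁ : s₁ ≠ σ.opp := by
    intro e; rw [e] at h1
    obtain ⟨f, hfD, hf⟩ := γ.arc_nth (i := i - 1) (by omega)
    rw [show i - 1 + 1 = i by omega, ← h1] at hf
    rcases arcFace_right_cases hf with rfl | rfl
    · have := γ.chain_nth (i := i - 1) (by omega)
      rw [show i - 1 + 1 = i by omega, show i - 1 + 2 = i + 1 by omega, hw] at this
      rw [h1] at hf
      exact this hf
    · exact ho hfD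
  have hs₁σ : s₁ ≠ σ := by
    intro e; rw [e] at h1
    have := γ.nth_inj (i := i) (j := 0) hi.le (Nat.zero_le _) (γ.nth_zero.trans h1).symm
    omega
  have hs₂σ : s₂ ≠ σ := by
    intro e; rw [e] at h2
    have := γ.nth_inj (i := i + 1) (j := 0) (by omega) (Nat.zero_le _) (γ.nth_zero.trans h2).symm
    omega
  -- the second mid-edge of the walk is a lateral side of `w`
  obtain ⟨t₀, s₀, -, ht₀, hs₀, -⟩ := exists_sides_of_arcFace h0
  simp only at ht₀ hs₀
  have hs₀σ : s₀ ≠ σ := by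
    intro e; rw [e] at hs₀
    have := γ.nth_inj (i := 1) (j := 0) (by omega) (Nat.zero_le _) (γ.nth_zero.trans hs₀).symm
    omega
  have hs₀o : s₀ ≠ σ.opp := by
    intro e; rw [e] at hs₀
    rcases opp_next 1 le_rfl (by omega) hs₀.symm with hlen | hw'
    · omega
    · exact γ.chain_nth (i := 0) (by omega) (by rw [h0, zero_add, hw'])
  rcases lateral_cases hs₀σ hs₀o hs₁σ hs₁ hs₂σ hs₂ hne with e | e
  · have := γ.nth_inj (i := 1) (j := i) (by omega) hi.le (by rw [← hs₀, e, h1])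
    omega
  · have := γ.nth_inj (i := 1) (j := i + 1) (by omega) (by omega) (by rw [← hs₀, e, h2])
    omega

end Isthmus

/-! ### The domain with the root plaquette removed; surgery of walks -/

section Surgery

variable {Dl : List Face} {w : Face} {σ : Side} {z : MidEdge}

/-- The face list with the plaquette `w` removed. [folklore] -/
def eraseFace (Dl : List Face) (w : Face) : List Face := Dl.filter fun f => decide (f ≠ w)

/-- Membership in the face list with `w` removed. [folklore] -/
private theorem mem_eraseFace {Dl : List Face} {w f : Face} : f ∈ eraseFace Dl w ↔ f ∈ Dl ∧ f ≠ w := by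
  simp [eraseFace]

/-- Removing a plaquette shrinks the domain. [folklore] -/
private theorem dom_eraseFace_subset (Dl : List Face) (w : Face) : dom (eraseFace Dl w) ⊆ dom Dl :=
  fun _ hf => (mem_eraseFace.1 hf).1

/-- An arc drawn in a plaquette of the domain with `w` removed is not drawn in `w`. [folklore] -/
private theorem arcFace_ne_of_mem_erase {p : MidEdge × MidEdge} {f : Face} (hf : f ∈ dom (eraseFace Dl w))
    (h : arcFace p = some f) : arcFace p ≠ some w := by
  rw [h]; exact fun e => (mem_eraseFace.1 hf).2 (Option.some_injective _ e)

/-- **The tail of a walk from an isthmus root**, as a walk of the domain with `w` removed (all its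
arcs avoid `w` by `arcFace_ne_of_pos`). [folklore] -/
def tailWalk (hh : nbr w σ ∉ dom Dl) (ho : nbr w σ.opp ∉ dom Dl) (hz : z ≠ w.side σ.opp)
    (γ : YBWalk (dom Dl) (w.side σ) z) (h0 : 0 < γ.arcs.length) : YBWalk (dom (eraseFace Dl w)) (γ.nth 1) z :=
  (YBWalk.ofFn (D := dom (eraseFace Dl w)) (γ.arcs.length - 1) (fun i => γ.nth (i + 1))
    (fun i j hi hj h => by have := γ.nth_inj (by omega) (by omega) h; omega)
    (fun i hi => by
      obtain ⟨f, hfD, hf⟩ := γ.arc_nth (i := i + 1) (by omega)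
      refine ⟨f, mem_eraseFace.2 ⟨hfD, ?_⟩, hf⟩
      rintro rfl
      exact arcFace_ne_of_pos hh ho hz γ (by omega) (by omega) hf)
    (fun i hi => by
      have h := γ.chain_nth (i := i + 1) (by omega)
      rwa [show i + 1 + 2 = i + 2 + 1 from by omega] at h)
    (fun i j hi hj f hWE => γ.nc_nth (by omega) (by omega) f hWE)).cast rfl
    (by rw [show γ.arcs.length - 1 + 1 = γ.arcs.length from by omega, γ.nth_length])

/-- The mid-edges of the tail walk are the tail of the mid-edges. [folklore] -/
private theorem tailWalk_mids (hh : nbr w σ ∉ dom Dl) (ho : nbr w σ.opp ∉ dom Dl) (hz : z ≠ w.side σ.opp)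
    (γ : YBWalk (dom Dl) (w.side σ) z) (h0 : 0 < γ.arcs.length) :
    (tailWalk hh ho hz γ h0).mids = γ.mids.tail := by
  rw [tailWalk, YBWalk.cast_mids, YBWalk.ofFn_mids]
  apply List.ext_getElem
  · rw [List.length_ofFn, List.length_tail, γ.length_eq]; omega
  · intro i h1 h2
    rw [List.getElem_ofFn, List.getElem_tail, ← γ.nth_eq_getElem]

/-- The index function of the prepended walk: the root first, then the given walk. [folklore] -/
def consFn (a : MidEdge) {D : Set Face} {b z : MidEdge} (δ : YBWalk D b z) : ℕ → MidEdge
  | 0 => a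
  | j + 1 => δ.nth j

/-- A walk of the domain with `w` removed does not cross the root `w.side σ`: both plaquettes of the
root are missing there. [folklore] -/
private theorem nth_ne_root (hh : nbr w σ ∉ dom Dl) {s : Side} (hs : s ≠ σ) (δ : YBWalk (dom (eraseFace Dl w)) (w.side s) z)
    {i : ℕ} (hi : i ≤ δ.arcs.length) : δ.nth i ≠ w.side σ := by
  intro e
  have hface : ∀ {p : MidEdge × MidEdge} {f : Face}, f ∈ dom (eraseFace Dl w) → arcFace p = some f →
      p.1 ≠ w.side σ ∧ p.2 ≠ w.side σ := by
    intro p f hf hp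
    obtain ⟨x, y⟩ := p
    constructor
    · rintro rfl
      rcases arcFace_left_cases hp with rfl | rfl
      · exact (mem_eraseFace.1 hf).2 rfl
      · exact hh (dom_eraseFace_subset _ _ hf)
    · rintro rfl
      rcases arcFace_right_cases hp with rfl | rfl
      · exact (mem_eraseFace.1 hf).2 rfl
      · exact hh (dom_eraseFace_subset _ _ hf)
  rcases Nat.eq_zero_or_pos δ.arcs.length with hlen | hpos
  · have e0 : δ.nth i = w.side s := by rw [show i = 0 by omega, δ.nth_zero]
    exact hs (Face.side_injective w (e0.symm.trans e))
  · rcases Nat.lt_or_ge i δ.arcs.length with hlt | hge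
    · obtain ⟨f, hfD, hf⟩ := δ.arc_nth hlt
      exact (hface hfD hf).1 e
    · obtain ⟨f, hfD, hf⟩ := δ.arc_nth (i := i - 1) (by omega)
      rw [show i - 1 + 1 = i from by omega] at hf
      exact (hface hfD hf).2 e

/-- **The walk with the root arc prepended**: from a walk of `D ∖ {w}` starting at the side `s ≠ σ`
of `w`, the walk of `D` from `w.side σ` whose first arc crosses `w` from `σ` to `s`. [folklore] -/
def consWalk (hw : w ∈ Dl) (hh : nbr w σ ∉ dom Dl) {s : Side} (hs : s ≠ σ)
    (δ : YBWalk (dom (eraseFace Dl w)) (w.side s) z) : YBWalk (dom Dl) (w.side σ) z :=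
  (YBWalk.ofFn (D := dom Dl) (δ.arcs.length + 1) (consFn (w.side σ) δ)
    (by
      intro i j hi hj h
      cases i with
      | zero =>
        cases j with
        | zero => rfl
        | succ j => exact absurd h.symm (nth_ne_root hh hs δ (by omega))
      | succ i =>
        cases j with
        | zero => exact absurd h (nth_ne_root hh hs δ (by omega))
        | succ j => have := δ.nth_inj (by omega) (by omega) h; omega)
    (by
      intro i hi
      cases i with
      | zero => exact ⟨w, hw, by show arcFace (w.side σ, δ.nth 0) = some w; rw [δ.nth_zero]; exact arcFace_side_side w σ s hs.symm⟩
      | succ i =>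
        obtain ⟨f, hfD, hf⟩ := δ.arc_nth (i := i) (by omega)
        exact ⟨f, dom_eraseFace_subset _ _ hfD, hf⟩)
    (by
      intro i hi
      cases i with
      | zero =>
        show arcFace (w.side σ, δ.nth 0) ≠ arcFace (δ.nth 0, δ.nth 1)
        obtain ⟨f, hfD, hf⟩ := δ.arc_nth (i := 0) (by omega)
        rw [hf, δ.nth_zero, arcFace_side_side w σ s hs.symm]
        exact fun e => (mem_eraseFace.1 hfD).2 (Option.some_injective _ e).symm
      | succ i => exact δ.chain_nth (i := i) (by omega))
    (by
      intro i j hi hj f hWE hSN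
      cases i with
      | zero =>
        have hfw : f = w := by
          have h1 := arcFace_of_isWE hWE
          change arcFace (w.side σ, δ.nth 0) = some f at h1
          rw [δ.nth_zero, arcFace_side_side w σ s hs.symm] at h1
          exact (Option.some_injective _ h1).symm
        subst hfw
        cases j with
        | zero =>
          change IsWE f (f.side σ, δ.nth 0) at hWE
          change IsSN f (f.side σ, δ.nth 0) at hSN
          rcases hWE with e | e <;> rcases hSN with e' | e' <;>
            · have h1 := (Prod.mk.inj e).1; have h2 := (Prod.mk.inj e').1
              exact absurd (Face.side_injective f (h1.symm.trans h2)) (by decide)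
        | succ j =>
          obtain ⟨g, hgD, hg⟩ := δ.arc_nth (i := j) (by omega)
          exact arcFace_ne_of_mem_erase hgD hg (arcFace_of_isSN hSN)
      | succ i =>
        cases j with
        | zero =>
          have hfw : f = w := by
            have h1 := arcFace_of_isSN hSN
            change arcFace (w.side σ, δ.nth 0) = some f at h1
            rw [δ.nth_zero, arcFace_side_side w σ s hs.symm] at h1
            exact (Option.some_injective _ h1).symm
          subst hfw
          obtain ⟨g, hgD, hg⟩ := δ.arc_nth (i := i) (by omega)
          exact arcFace_ne_of_mem_erase hgD hg (arcFace_of_isWE hWE)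
        | succ j => exact δ.nc_nth (by omega) (by omega) f hWE hSN)).cast rfl δ.nth_length

/-- The mid-edges of the prepended walk. [folklore] -/
private theorem consWalk_mids (hw : w ∈ Dl) (hh : nbr w σ ∉ dom Dl) {s : Side} (hs : s ≠ σ)
    (δ : YBWalk (dom (eraseFace Dl w)) (w.side s) z) : (consWalk hw hh hs δ).mids = w.side σ :: δ.mids := by
  rw [consWalk, YBWalk.cast_mids, YBWalk.ofFn_mids]
  apply List.ext_getElem
  · rw [List.length_ofFn, List.length_cons, δ.length_eq]
  · intro i h1 h2
    rw [List.getElem_ofFn]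
    cases i with
    | zero => rfl
    | succ i =>
      rw [List.getElem_cons_succ, ← δ.nth_eq_getElem]
      rfl

end Surgery

/-! ### Weight and winding of a walk with the root arc prepended -/

section Lists

/-- The arcs of a list with two explicit first entries. [folklore] -/
private theorem arcsOf_cons_cons (a e : MidEdge) (rest : List MidEdge) :
    arcsOf (a :: e :: rest) = (a, e) :: arcsOf (e :: rest) := rfl

/-- Quarter turns of a list with the first arc split off. [folklore] -/
private theorem quarterTurnsL_cons_cons (a e : MidEdge) (rest : List MidEdge) :
    quarterTurnsL (a :: e :: rest) = qTurnOf (a, e) + quarterTurnsL (e :: rest) := by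
  simp [quarterTurnsL]

variable {a e : MidEdge} {rest : List MidEdge} {w : Face} {k : ArcKind}

/-- The visited plaquettes when the first arc lies in a plaquette no other arc visits. [folklore] -/
private theorem facesL_cons_cons (hw : arcFace (a, e) = some w) (hA : ∀ p ∈ arcsOf (e :: rest), arcFace p ≠ some w) :
    facesL (a :: e :: rest) = w :: facesL (e :: rest) := by
  unfold facesL
  rw [arcsOf_cons_cons, List.filterMap_cons_some hw, List.dedup_cons_of_notMem]
  intro hmem
  obtain ⟨p, hp, hpw⟩ := List.mem_filterMap.1 hmem
  exact hA p hp hpw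

/-- The plaquette of the first arc carries exactly that arc. [folklore] -/
private theorem kindsL_cons_cons_self (hw : arcFace (a, e) = some w) (hk : arcKindOf (a, e) = some k)
    (hA : ∀ p ∈ arcsOf (e :: rest), arcFace p ≠ some w) : kindsL (a :: e :: rest) w = [k] := by
  unfold kindsL
  rw [arcsOf_cons_cons, List.filterMap_cons_some (by rw [if_pos hw, hk])]
  congr 1
  rw [List.filterMap_eq_nil_iff]
  intro p hp
  rw [if_neg (hA p hp)]

/-- The other plaquettes carry the arcs of the tail. [folklore] -/
private theorem kindsL_cons_cons_of_ne (hw : arcFace (a, e) = some w) {f : Face} (hf : f ≠ w) :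
    kindsL (a :: e :: rest) f = kindsL (e :: rest) f := by
  unfold kindsL
  rw [arcsOf_cons_cons, List.filterMap_cons_none]
  rw [hw, if_neg (fun h => hf (Option.some_injective _ h).symm)]

/-- Configuration counts with the first arc split off. [folklore] -/
private theorem cfgCount_cons_cons (hw : arcFace (a, e) = some w) (hk : arcKindOf (a, e) = some k)
    (hA : ∀ p ∈ arcsOf (e :: rest), arcFace p ≠ some w) (κ : List ArcKind) :
    cfgCount (a :: e :: rest) κ = cfgCount (e :: rest) κ + (if [k] = κ then 1 else 0) := by
  unfold cfgCount
  rw [facesL_cons_cons hw hA, List.countP_cons, kindsL_cons_cons_self hw hk hA]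
  have hnot : w ∉ facesL (e :: rest) := by
    unfold facesL
    rw [List.mem_dedup]
    intro hmem
    obtain ⟨p, hp, hpw⟩ := List.mem_filterMap.1 hmem
    exact hA p hp hpw
  congr 1
  · refine List.countP_congr fun f hf => ?_
    rw [kindsL_cons_cons_of_ne hw (fun h => hnot (h ▸ hf))]
  · simp

/-- The weight of a single arc by kind (`u₁`, `u₂`, `v`; a degenerate "arc" changes nothing).
[cite: GlazmanManolescu2019, §1, Fig. 1, eq. (1)] -/
def arcW (W : CWeights) : ArcKind → ℂ
  | .corner => W.u₁
  | .coCorner => W.u₂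
  | .straight => W.v
  | .degen => 1

/-- **The plaquette weight with the first arc split off**: the first plaquette, visited by that arc
only, contributes its one-arc weight. [cite: GlazmanManolescu2019, §1 (the weight is the product over the rhombi)] -/
theorem weightL_cons_cons (W : CWeights) (hw : arcFace (a, e) = some w) (hk : arcKindOf (a, e) = some k)
    (hA : ∀ p ∈ arcsOf (e :: rest), arcFace p ≠ some w) :
    weightL W (a :: e :: rest) = arcW W k * weightL W (e :: rest) := by
  unfold weightL
  simp only [cfgCount_cons_cons hw hk hA]
  cases k <;> simp [CWeights.mono, arcW, pow_succ] <;> ring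

end Lists

/-! ### Every walk from an isthmus root is a prepended walk -/

section Cover

variable {Dl : List Face} {w : Face} {σ : Side} {z : MidEdge}

/-- **Covering**: a walk from the isthmus root to an end other than the root and the opposite side
is the root arc prepended to a walk of `D ∖ {w}` from another side of `w`. [folklore] -/
private theorem exists_consWalk (hw : w ∈ Dl) (hh : nbr w σ ∉ dom Dl) (ho : nbr w σ.opp ∉ dom Dl)
    (hz : z ≠ w.side σ.opp) (hz' : z ≠ w.side σ) (γ : YBWalk (dom Dl) (w.side σ) z) :
    ∃ (s : Side) (hs : s ≠ σ) (δ : YBWalk (dom (eraseFace Dl w)) (w.side s) z),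
      (consWalk hw hh hs δ).mids = γ.mids := by
  have h0 : 0 < γ.arcs.length := by
    by_contra h
    have e := γ.nth_length
    rw [show γ.arcs.length = 0 by omega, γ.nth_zero] at e
    exact hz' e.symm
  obtain ⟨t₀, s, -, -, hs, -⟩ := exists_sides_of_arcFace (arcFace_zero_eq hh γ h0)
  simp only at hs
  have hsσ : s ≠ σ := by
    intro e; rw [e] at hs
    have := γ.nth_inj (i := 1) (j := 0) (by omega) (Nat.zero_le _) (γ.nth_zero.trans hs).symm
    omega
  refine ⟨s, hsσ, (tailWalk hh ho hz γ h0).cast hs.symm rfl, ?_⟩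
  rw [consWalk_mids, YBWalk.cast_mids, tailWalk_mids]
  obtain ⟨hd, tl, e⟩ := List.exists_cons_of_ne_nil γ.mids_ne_nil
  have hhd : hd = w.side σ := by
    have h := γ.head_eq; rw [e] at h; exact Option.some_injective _ h
  rw [e, hhd]; rfl

/-- The prepended walks are distinct for distinct data. [folklore] -/
private theorem consWalk_injective (hw : w ∈ Dl) (hh : nbr w σ ∉ dom Dl) {s : Side} (hs : s ≠ σ) :
    Function.Injective (consWalk (z := z) hw hh hs) := by
  intro δ δ' h
  have hm := congrArg YBWalk.mids h
  rw [consWalk_mids, consWalk_mids] at hm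
  exact YBWalk.ext (List.cons_injective hm)

/-- Prepended walks from different sides are different. [folklore] -/
private theorem consWalk_ne (hw : w ∈ Dl) (hh : nbr w σ ∉ dom Dl) {s s' : Side} (hs : s ≠ σ) (hs' : s' ≠ σ) (hss : s ≠ s')
    (δ : YBWalk (dom (eraseFace Dl w)) (w.side s) z) (δ' : YBWalk (dom (eraseFace Dl w)) (w.side s') z) :
    consWalk hw hh hs δ ≠ consWalk hw hh hs' δ' := by
  intro h
  have hm := congrArg YBWalk.mids h
  rw [consWalk_mids, consWalk_mids] at hm
  have h1 := List.cons_injective hm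
  have h2 : δ.mids.head? = δ'.mids.head? := by rw [h1]
  rw [δ.head_eq, δ'.head_eq] at h2
  exact hss (Face.side_injective w (Option.some_injective _ h2))

/-- The summand of the observable for a prepended walk: the root arc contributes its one-arc weight
and its quarter turn. [cite: GlazmanManolescu2019, §2.1, eq. (2.1)] -/
theorem summand_consWalk (W : CWeights) {t : ℂ} (ht : t ≠ 0) (hw : w ∈ Dl) (hh : nbr w σ ∉ dom Dl) {s : Side}
    (hs : s ≠ σ) (δ : YBWalk (dom (eraseFace Dl w)) (w.side s) z) :
    weightL W (consWalk hw hh hs δ).mids * t ^ quarterTurnsL (consWalk hw hh hs δ).mids =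
      (arcW W (arcKind σ s) * t ^ qTurn σ s) * (weightL W δ.mids * t ^ quarterTurnsL δ.mids) := by
  rw [consWalk_mids]
  obtain ⟨hd, tl, e⟩ := List.exists_cons_of_ne_nil δ.mids_ne_nil
  have hhd : hd = w.side s := by
    have h := δ.head_eq; rw [e] at h; exact Option.some_injective _ h
  have hwf : arcFace (w.side σ, w.side s) = some w := arcFace_side_side w σ s hs.symm
  have hk : arcKindOf (w.side σ, w.side s) = some (arcKind σ s) := arcKindOf_eq hwf rfl rfl
  have hA : ∀ p ∈ arcsOf δ.mids, arcFace p ≠ some w := fun p hp => by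
    obtain ⟨f, hfD, hf⟩ := δ.arc_mem p hp
    exact arcFace_ne_of_mem_erase hfD hf
  have hq : qTurnOf (w.side σ, w.side s) = qTurn σ s := by
    unfold qTurnOf; rw [hwf]; simp [Face.sideOf_side]
  rw [e, hhd] at hA ⊢
  rw [weightL_cons_cons W hwf hk hA, quarterTurnsL_cons_cons, zpow_add₀ ht, hq]
  ring

end Cover

/-! ### The decomposition of the observable and of the vertex functional -/

section Decomposition

variable {Dl : List Face} {w : Face} {σ : Side}

/-- The coefficient of the root arc `σ → s` inside `w`: its one-arc weight times its phase.
[cite: GlazmanManolescu2019, §2.1, eq. (2.1)] -/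
def rootCoeff (W : CWeights) (t : ℂ) (σ s : Side) : ℂ := arcW W (arcKind σ s) * t ^ qTurn σ s

/-- **Decomposition of the observable at an isthmus root**: for an end mid-edge other than the root
and the opposite side of `w`, the observable from `w.side σ` in `D` is the combination, over the three
other sides `s` of `w`, of the root-arc coefficient times the observable from `w.side s` in `D ∖ {w}`.
[cite: GlazmanManolescu2019, §2.1, eq. (2.1) (the observable as a sum over walks)] -/
theorem gmObservable_isthmus (W : CWeights) {t : ℂ} (ht : t ≠ 0) (hw : w ∈ Dl) (hh : nbr w σ ∉ dom Dl)
    (ho : nbr w σ.opp ∉ dom Dl) {zz : MidEdge} (hz : zz ≠ w.side σ.opp) (hz' : zz ≠ w.side σ) :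
    gmObservable W t Dl (w.side σ) zz =
      ∑ s ∈ Finset.univ.erase σ, rootCoeff W t σ s * gmObservable W t (eraseFace Dl w) (w.side s) zz := by
  classical
  unfold gmObservable
  let I : Side → Finset (YBWalk (dom Dl) (w.side σ) zz) :=
    fun s => if hs : s ≠ σ then Finset.univ.image (consWalk (z := zz) hw hh hs) else ∅
  have hIs : ∀ {s : Side} (hs : s ≠ σ), I s = Finset.univ.image (consWalk (z := zz) hw hh hs) :=
    fun hs => dif_pos hs
  have hcover : (Finset.univ : Finset (YBWalk (dom Dl) (w.side σ) zz)) = (Finset.univ.erase σ).biUnion I := by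
    ext γ
    constructor
    · intro _
      rw [Finset.mem_biUnion]
      obtain ⟨s, hs, δ, hm⟩ := exists_consWalk hw hh ho hz hz' γ
      refine ⟨s, Finset.mem_erase.2 ⟨hs, Finset.mem_univ _⟩, ?_⟩
      rw [hIs hs]
      exact Finset.mem_image.2 ⟨δ, Finset.mem_univ _, YBWalk.ext hm⟩
    · intro _; exact Finset.mem_univ _
  have hdisj : ((Finset.univ.erase σ : Finset Side) : Set Side).PairwiseDisjoint I := by
    intro s hs s' hs' hss
    have h1 : s ≠ σ := (Finset.mem_erase.1 (Finset.mem_coe.1 hs)).1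
    have h2 : s' ≠ σ := (Finset.mem_erase.1 (Finset.mem_coe.1 hs')).1
    change Disjoint (I s) (I s')
    rw [hIs h1, hIs h2, Finset.disjoint_left]
    intro γ hγ hγ'
    obtain ⟨δ, -, rfl⟩ := Finset.mem_image.1 hγ
    obtain ⟨δ', -, h⟩ := Finset.mem_image.1 hγ'
    exact consWalk_ne hw hh h2 h1 (Ne.symm hss) δ' δ h
  rw [hcover, Finset.sum_biUnion hdisj]
  refine Finset.sum_congr rfl fun s hs => ?_
  have hs' : s ≠ σ := (Finset.mem_erase.1 hs).1
  rw [hIs hs', Finset.sum_image fun δ _ δ' _ h => consWalk_injective hw hh hs' h, Finset.mul_sum]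
  refine Finset.sum_congr rfl fun δ _ => ?_
  rw [summand_consWalk W ht hw hh hs' δ, rootCoeff]

/-- The sides of a plaquette `f₀ ∈ D`, `f₀ ≠ w`, are neither the root nor the opposite side of `w`.
[folklore] -/
private theorem slotSide_ne (hh : nbr w σ ∉ dom Dl) (ho : nbr w σ.opp ∉ dom Dl) {f₀ : Face} (hf : f₀ ∈ Dl)
    (hne : f₀ ≠ w) (k : Fin 4) : slotSide f₀ k ≠ w.side σ.opp ∧ slotSide f₀ k ≠ w.side σ := by
  have key : ∀ (u v : Side), nbr w v ∉ dom Dl → f₀.side u ≠ w.side v := by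
    intro u v hv e
    rcases eq_or_eq_nbr_of_faces ((Face.exists_side_eq_iff f₀ (w.side v)).1 ⟨u, e⟩) with h | h
    · exact hne h
    · exact hv (h ▸ hf)
  fin_cases k
  · exact ⟨key .E _ ho, key .E _ hh⟩
  · exact ⟨key .N _ ho, key .N _ hh⟩
  · exact ⟨key .W _ ho, key .W _ hh⟩
  · exact ⟨key .S _ ho, key .S _ hh⟩

/-- **Decomposition of the vertex functional at an isthmus root**, at every plaquette `f₀ ∈ D` other
than `w`. [cite: DuminilCopinSmirnov2012, Lemma 1 (shape of the relation)] -/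
theorem vertexFunctional_isthmus (W : CWeights) {t : ℂ} (ht : t ≠ 0) (c : Fin 4 → ℂ) (hw : w ∈ Dl)
    (hh : nbr w σ ∉ dom Dl) (ho : nbr w σ.opp ∉ dom Dl) {f₀ : Face} (hf : f₀ ∈ Dl) (hne : f₀ ≠ w) :
    vertexFunctional W t c Dl (w.side σ) f₀ =
      ∑ s ∈ Finset.univ.erase σ, rootCoeff W t σ s * vertexFunctional W t c (eraseFace Dl w) (w.side s) f₀ := by
  unfold vertexFunctional
  calc ∑ k : Fin 4, c k * gmObservable W t Dl (w.side σ) (slotSide f₀ k)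
      = ∑ k : Fin 4, ∑ s ∈ Finset.univ.erase σ,
          rootCoeff W t σ s * (c k * gmObservable W t (eraseFace Dl w) (w.side s) (slotSide f₀ k)) := by
        refine Finset.sum_congr rfl fun k _ => ?_
        rw [gmObservable_isthmus W ht hw hh ho (slotSide_ne hh ho hf hne k).1 (slotSide_ne hh ho hf hne k).2,
          Finset.mul_sum]
        refine Finset.sum_congr rfl fun s _ => ?_
        ring
    _ = ∑ s ∈ Finset.univ.erase σ, rootCoeff W t σ s *
          ∑ k : Fin 4, c k * gmObservable W t (eraseFace Dl w) (w.side s) (slotSide f₀ k) := by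
        rw [Finset.sum_comm]
        refine Finset.sum_congr rfl fun s _ => ?_
        rw [Finset.mul_sum]

end Decomposition

/-! ### The identity away from the root plaquette -/

section Main

variable {Dl : List Face} {w : Face} {σ : Side}

/-- The exterior chain of `D ∖ {w}` from a side of `w`: first `w`, then the given chain. [folklore] -/
def chainFn (w : Face) (g : ℕ → Face) : ℕ → Face
  | 0 => w
  | j + 1 => g j

/-- For an isthmus root the plaquette across the opposite side is outside the domain. [folklore] -/
private theorem nbr_opp_not_mem (hw : w ∈ Dl) (hO : OuterRoot (dom Dl) (w.side σ.opp)) : nbr w σ.opp ∉ dom Dl := by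
  obtain ⟨n, g, ⟨s₀, hs₀⟩, hD, -, -⟩ := hO
  rcases eq_or_eq_nbr_of_faces ((Face.exists_side_eq_iff (g 0) (w.side σ.opp)).1 ⟨s₀, hs₀⟩) with h | h
  · exact absurd (h ▸ (hw : w ∈ dom Dl)) (hD 0 (Nat.zero_le _))
  · exact h ▸ hD 0 (Nat.zero_le _)

/-- **Every side of `w` is an outer root of `D ∖ {w}`** when the opposite side of the root is an outer
root of `D`: the exterior chain starts with `w` itself and continues through the plaquette across.
[cite: DuminilCopinSmirnov2012, Lemma 1 (a ∈ ∂Ω: the root on the outer boundary)] -/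
theorem outerRoot_eraseFace (hw : w ∈ Dl) (hO : OuterRoot (dom Dl) (w.side σ.opp)) (s : Side) :
    OuterRoot (dom (eraseFace Dl w)) (w.side s) := by
  obtain ⟨n, g, ⟨s₀, hs₀⟩, hD, hlink, hbey⟩ := hO
  have hg0 : g 0 = nbr w σ.opp := by
    rcases eq_or_eq_nbr_of_faces ((Face.exists_side_eq_iff (g 0) (w.side σ.opp)).1 ⟨s₀, hs₀⟩) with h | h
    · exact absurd (h ▸ (hw : w ∈ dom Dl)) (hD 0 (Nat.zero_le _))
    · exact h
  refine ⟨n + 1, chainFn w g, ⟨s, rfl⟩, ?_, ?_, ?_⟩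
  · intro i hi
    cases i with
    | zero => exact fun h => (mem_eraseFace.1 h).2 rfl
    | succ j => exact fun h => hD j (by omega) (dom_eraseFace_subset _ _ h)
  · intro i hi
    cases i with
    | zero =>
      show ∃ q, IsCornerOf q w ∧ IsCornerOf q (g 0)
      rw [hg0]; exact exists_corner_nbr w σ.opp
    | succ j => exact hlink j (by omega)
  · show (∀ f ∈ dom (eraseFace Dl w), (g n).1 < f.1) ∨ (∀ f ∈ dom (eraseFace Dl w), f.1 < (g n).1) ∨
      (∀ f ∈ dom (eraseFace Dl w), (g n).2 < f.2) ∨ (∀ f ∈ dom (eraseFace Dl w), f.2 < (g n).2)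
    rcases hbey with h | h | h | h
    · exact Or.inl fun f hf => h f (dom_eraseFace_subset _ _ hf)
    · exact Or.inr (Or.inl fun f hf => h f (dom_eraseFace_subset _ _ hf))
    · exact Or.inr (Or.inr (Or.inl fun f hf => h f (dom_eraseFace_subset _ _ hf)))
    · exact Or.inr (Or.inr (Or.inr fun f hf => h f (dom_eraseFace_subset _ _ hf)))

/-- **The Yang–Baxter vertex identity away from the root plaquette of an isthmus root.** For every
`θ ∈ [π/3, 2π/3]`, every finite face list `Dl`, every plaquette `w ∈ Dl` and side `σ` with the
plaquette across `w.side σ` outside the domain (so `w.side σ` is a boundary root, possibly on the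
boundary of a HOLE) and the opposite side `w.side σ.opp` an OUTER root, the vertex functional of the
printed weights with the Yang–Baxter coefficients `(1, r(θ), −1, −r(θ))` vanishes at every plaquette
`f₀ ∈ Dl` other than `w`. New (hole roots are outside the printed hypotheses of
[cite: DuminilCopinSmirnov2012, Lemma 1 (Ω simply connected, a ∈ ∂Ω)] and
[cite: GlazmanManolescu2019, Lemma 2.1 (walks from the boundary point 0 of the rectangle)]); proved by
reduction to the tree's outer-root theorem `vertexFunctional_printed_eq_zero` on `D ∖ {w}`. -/
theorem vertexFunctional_printed_eq_zero_of_isthmus {θ : ℝ} (hθ : θ ∈ Set.Icc (π / 3) (2 * π / 3))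
    (Dl : List Face) (w : Face) (σ : Side) (hw : w ∈ Dl) (hh : nbr w σ ∉ dom Dl)
    (hO : OuterRoot (dom Dl) (w.side σ.opp)) (f₀ : Face) (hf : f₀ ∈ Dl) (hne : f₀ ≠ w) :
    vertexFunctional (printedWeights θ) tFiveEighths (ybCoeff θ) Dl (w.side σ) f₀ = 0 := by
  rw [vertexFunctional_isthmus _ tFiveEighths_ne_zero _ hw hh (nbr_opp_not_mem hw hO) hf hne]
  refine Finset.sum_eq_zero fun s _ => ?_
  rw [vertexFunctional_printed_eq_zero hθ (eraseFace Dl w) (w.side s) (outerRoot_eraseFace hw hO s) f₀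
    (mem_eraseFace.2 ⟨hf, hne⟩), mul_zero]

/-- **The same on the whole complexified Yang–Baxter curve** (`σ = 5/8`, odd component): for every
`r ≠ 0` off the denominator `t⁶(1 + r⁴) − (1 + t¹²)r² = 0`, the vertex functional of the curve weights
`ybCurve (−1) t r` with the coefficients `(1, r, −1, −r)` from an isthmus root vanishes at every plaquette
other than the root plaquette. Reduction to the tree's `vertexFunctional_ybCurve_eq_zero`.
[cite: GlazmanManolescu2019, Lemma 2.1 (the identity; here at complex coefficient ratio and beyond the printed root hypothesis)] -/
theorem vertexFunctional_ybCurve_eq_zero_of_isthmus {r : ℂ} (hr : r ≠ 0)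
    (hD : tFiveEighths ^ 6 * (1 + r ^ 4) - (1 + tFiveEighths ^ 12) * r ^ 2 ≠ 0)
    (Dl : List Face) (w : Face) (σ : Side) (hw : w ∈ Dl) (hh : nbr w σ ∉ dom Dl)
    (hO : OuterRoot (dom Dl) (w.side σ.opp)) (f₀ : Face) (hf : f₀ ∈ Dl) (hne : f₀ ≠ w) :
    vertexFunctional (ybCurve (-1) tFiveEighths r) tFiveEighths (oddCoeff r) Dl (w.side σ) f₀ = 0 := by
  rw [vertexFunctional_isthmus _ tFiveEighths_ne_zero _ hw hh (nbr_opp_not_mem hw hO) hf hne]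
  refine Finset.sum_eq_zero fun s _ => ?_
  rw [vertexFunctional_ybCurve_eq_zero hr hD (eraseFace Dl w) (w.side s) (outerRoot_eraseFace hw hO s) f₀
    (mem_eraseFace.2 ⟨hf, hne⟩), mul_zero]

/-- **Named statement** («YB identity at isthmus hole roots, away from the root plaquette»): for every
`θ ∈ [π/3, 2π/3]`, every finite face list `Dl`, every `w ∈ Dl`, every side `σ` whose outward
plaquette is missing from the domain while the opposite side of `w` is an outer root, and every
plaquette `f₀ ∈ Dl`, `f₀ ≠ w`, the Yang–Baxter vertex functional from the root `w.side σ` vanishes at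
`f₀`. [cite: GlazmanManolescu2019, Lemma 2.1 (the identity; here beyond its printed root hypothesis)] -/
def _root_.Literature.Barriers.CriticalPhenomena.PlaquetteWalkYBIdentityIsthmus : Prop :=
  ∀ θ : ℝ, θ ∈ Set.Icc (π / 3) (2 * π / 3) → ∀ (Dl : List Face) (w : Face) (σ : Side) (f₀ : Face),
    w ∈ Dl → nbr w σ ∉ dom Dl → OuterRoot (dom Dl) (w.side σ.opp) → f₀ ∈ Dl → f₀ ≠ w →
      vertexFunctional (printedWeights θ) tFiveEighths (ybCoeff θ) Dl (w.side σ) f₀ = 0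

/-- The isthmus identity holds. [cite: GlazmanManolescu2019, Lemma 2.1] -/
theorem _root_.Literature.Barriers.CriticalPhenomena.PlaquetteWalkYBIdentityIsthmus_holds :
    PlaquetteWalkYBIdentityIsthmus :=
  fun _ hθ Dl w σ f₀ hw hh hO hf hne => vertexFunctional_printed_eq_zero_of_isthmus hθ Dl w σ hw hh hO f₀ hf hne

end Main

/-! ## Part 2. The defect at the root plaquette

For an isthmus root the identity FAILS at `f₀ = w` (lane numerics). The same surgery expresses the
vertex functional AT `w` exactly: the walks from `a = w.side σ` ending on `∂w` are the trivial walk,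
the three one-arc walks, the walks `a → w.side s → ⋯ → w.side s.opp` through `D ∖ {w}` (ending on a
lateral side), and those same walks closed by the second arc of `w` into the opposite side. Hence
(`vertexFunctional_isthmus_root`) the functional at `w` equals the functional of the ONE-plaquette
domain `[w]` (which vanishes for the Yang–Baxter weights: `a` is an outer root of `{w}`) plus, for each
lateral side `s`, an explicit local coefficient times the observable of `D ∖ {w}` from `w.side s` to
the opposite lateral side `w.side s.opp` — the hole defect is carried entirely by the two
boundary-to-boundary observables of `D ∖ {w}` across the slot.

Status in print (lit-2 g16, 2026-08-23): the SHAPE «defect = local constant × slot-crossing partition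
function» is printed for a different defect — the surface-weight defect of
[cite: BeatonBousquetMelouDeGierDuminilCopinGuttmann2014, Lemma 3, second part, eq. (7) (arXiv v5 pp. 4–6: the surface-vertex defect (1−y)(x_c yλ)^{−1} × slot-crossing partition function; Fig. 4; «so the last term in parentheses must be (1−y)»)]
— and the group-by-outside-pattern bookkeeping is the printed proof of every vertex relation
[cite: DuminilCopinSmirnov2012, proof of Lemma 1 (arXiv p. 4: group brackets)]; the hole-root (topological)
defect identity proved here is not located in print — NEW-IN-WRITING modest. -/

section Defect

variable {Dl : List Face} {w : Face} {σ : Side} {z : MidEdge}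

/-- A walk from `a` to `a` is the trivial walk. [folklore] -/
private theorem mids_eq_singleton_of_end_eq (γ : YBWalk (dom Dl) z z) : γ.mids = [z] := by
  have h0 : γ.arcs.length = 0 := by
    have := γ.nth_inj (i := 0) (j := γ.arcs.length) (Nat.zero_le _) le_rfl (by rw [γ.nth_zero, γ.nth_length])
    omega
  have hl : γ.mids.length = 1 := by rw [γ.length_eq, h0]
  obtain ⟨hd, tl, e⟩ := List.exists_cons_of_ne_nil γ.mids_ne_nil
  have hhd : hd = z := by have h := γ.head_eq; rw [e] at h; exact Option.some_injective _ h
  have htl : tl = [] := by rw [e, List.length_cons] at hl; exact List.eq_nil_of_length_eq_zero (by omega)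
  rw [e, hhd, htl]

/-- **The observable at the root itself is `1`** (only the trivial walk). [cite: GlazmanManolescu2019, §2.1, eq. (2.1)] -/
theorem gmObservable_root (W : CWeights) (t : ℂ) (Dl : List Face) (a : MidEdge) : gmObservable W t Dl a a = 1 := by
  unfold gmObservable
  rw [Fintype.sum_eq_single (YBWalk.trivial a) (fun γ hγ => absurd (YBWalk.ext
    ((mids_eq_singleton_of_end_eq γ).trans (mids_eq_singleton_of_end_eq (YBWalk.trivial a)).symm)) hγ)]
  rw [mids_eq_singleton_of_end_eq]
  simp [weightL, cfgCount, facesL, quarterTurnsL, arcsOf, CWeights.mono]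

/-- The weight of a plaquette crossed by two arcs of the same kind (`w₁` for two corner arcs, `w₂` for
two co-corner arcs; two straight arcs never occur). [cite: GlazmanManolescu2019, §1, Fig. 1, eq. (1)] -/
def pairW (W : CWeights) : ArcKind → ℂ
  | .corner => W.w₁
  | .coCorner => W.w₂
  | .straight => 0
  | .degen => 0

/-- The coefficient of a walk that crosses `w` twice: root arc `σ → s`, and later the closing arc
`s.opp → σ.opp` into the opposite side (two arcs of the same kind), with both quarter turns.
[cite: GlazmanManolescu2019, §2.1, eq. (2.1)] -/
def pairCoeff (W : CWeights) (t : ℂ) (σ s : Side) : ℂ :=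
  pairW W (arcKind σ s) * t ^ (qTurn σ s + qTurn s.opp σ.opp)

/-- The arcs of a list with one more mid-edge appended. [folklore] -/
private theorem arcsOf_append_singleton (x : MidEdge) (rest : List MidEdge) (e : MidEdge) :
    arcsOf (x :: rest ++ [e]) = arcsOf (x :: rest) ++ [((x :: rest).getLast (List.cons_ne_nil _ _), e)] := by
  induction rest generalizing x with
  | nil => rfl
  | cons y rest ih =>
    rw [List.cons_append, List.cons_append, arcsOf_cons_cons, ← List.cons_append, ih y, arcsOf_cons_cons,
      List.cons_append, List.getLast_cons_cons]

variable {a h e : MidEdge} {rest : List MidEdge} {k₁ k₂ : ArcKind}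

/-- The arcs of the sandwich list: root arc, the middle, the closing arc. [folklore] -/
private theorem arcsOf_sandwich (a h e : MidEdge) (rest : List MidEdge) :
    arcsOf (a :: (h :: rest ++ [e])) =
      (a, h) :: (arcsOf (h :: rest) ++ [((h :: rest).getLast (List.cons_ne_nil _ _), e)]) := by
  rw [show a :: (h :: rest ++ [e]) = (a :: h :: rest) ++ [e] from rfl, arcsOf_append_singleton, arcsOf_cons_cons,
    List.cons_append, List.getLast_cons_cons]

/-- Configuration counts of the sandwich list: `w` carries the two arcs, the rest is the middle's.
[folklore] -/
private theorem cfgCount_sandwich (hw₁ : arcFace (a, h) = some w) (hk₁ : arcKindOf (a, h) = some k₁)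
    (hw₂ : arcFace ((h :: rest).getLast (List.cons_ne_nil _ _), e) = some w)
    (hk₂ : arcKindOf ((h :: rest).getLast (List.cons_ne_nil _ _), e) = some k₂)
    (hA : ∀ p ∈ arcsOf (h :: rest), arcFace p ≠ some w) (κ : List ArcKind) :
    cfgCount (a :: (h :: rest ++ [e])) κ = cfgCount (h :: rest) κ + (if [k₁, k₂] = κ then 1 else 0) := by
  have harcs := arcsOf_sandwich a h e rest
  have hnot : w ∉ facesL (h :: rest) := by
    unfold facesL; rw [List.mem_dedup]
    intro hmem
    obtain ⟨p, hp, hpw⟩ := List.mem_filterMap.1 hmem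
    exact hA p hp hpw
  have hkw : kindsL (a :: (h :: rest ++ [e])) w = [k₁, k₂] := by
    unfold kindsL
    rw [harcs, List.filterMap_cons_some (by rw [if_pos hw₁, hk₁]), List.filterMap_append,
      List.filterMap_cons_some (by rw [if_pos hw₂, hk₂]), List.filterMap_nil]
    have hmid : (arcsOf (h :: rest)).filterMap (fun p => if arcFace p = some w then arcKindOf p else none) = [] := by
      rw [List.filterMap_eq_nil_iff]; intro p hp; rw [if_neg (hA p hp)]
    rw [hmid]; rfl
  have hkf : ∀ f, f ≠ w → kindsL (a :: (h :: rest ++ [e])) f = kindsL (h :: rest) f := by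
    intro f hf
    unfold kindsL
    rw [harcs, List.filterMap_cons_none (by rw [hw₁, if_neg (fun h => hf (Option.some_injective _ h).symm)]),
      List.filterMap_append,
      List.filterMap_cons_none (by rw [hw₂, if_neg (fun h => hf (Option.some_injective _ h).symm)]),
      List.filterMap_nil, List.append_nil]
  have hperm : (facesL (a :: (h :: rest ++ [e]))).Perm (w :: facesL (h :: rest)) := by
    refine List.perm_of_nodup_nodup_toFinset_eq (List.nodup_dedup _) (List.nodup_cons.2 ⟨hnot, List.nodup_dedup _⟩) ?_
    unfold facesL
    rw [harcs, List.filterMap_cons_some hw₁, List.filterMap_append, List.filterMap_cons_some hw₂, List.filterMap_nil]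
    ext f
    simp only [List.mem_toFinset, List.mem_dedup, List.mem_cons, List.mem_append]
    tauto
  unfold cfgCount
  rw [hperm.countP_eq, List.countP_cons, hkw]
  congr 1
  · refine List.countP_congr fun f hf => ?_
    rw [hkf f (fun h => hnot (h ▸ hf))]
  · simp

/-- **The weight of the sandwich walk**: the two arcs of `w` (same kind) contribute the two-arc weight.
[cite: GlazmanManolescu2019, §1 (the weight is the product over the rhombi)] -/
theorem weightL_sandwich (W : CWeights) (hw₁ : arcFace (a, h) = some w) (hk₁ : arcKindOf (a, h) = some k₁)
    (hw₂ : arcFace ((h :: rest).getLast (List.cons_ne_nil _ _), e) = some w)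
    (hk₂ : arcKindOf ((h :: rest).getLast (List.cons_ne_nil _ _), e) = some k₁)
    (hA : ∀ p ∈ arcsOf (h :: rest), arcFace p ≠ some w) (hk : k₁ = .corner ∨ k₁ = .coCorner) :
    weightL W (a :: (h :: rest ++ [e])) = pairW W k₁ * weightL W (h :: rest) := by
  unfold weightL
  simp only [cfgCount_sandwich hw₁ hk₁ hw₂ hk₂ hA]
  rcases hk with rfl | rfl <;> simp [CWeights.mono, pairW, pow_succ] <;> ring

/-- Quarter turns of the sandwich list. [folklore] -/
private theorem quarterTurnsL_sandwich (a h e : MidEdge) (rest : List MidEdge) :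
    quarterTurnsL (a :: (h :: rest ++ [e])) =
      qTurnOf (a, h) + quarterTurnsL (h :: rest) + qTurnOf ((h :: rest).getLast (List.cons_ne_nil _ _), e) := by
  unfold quarterTurnsL
  rw [arcsOf_sandwich]
  simp [add_assoc]

end Defect

/-! ### Walks from the root to the opposite side: the closing arc -/

section Closing

variable {Dl : List Face} {w : Face} {σ : Side} {z : MidEdge}

/-- The opposite of the opposite side. [folklore] -/
private theorem Side.opp_opp (s : Side) : s.opp.opp = s := by cases s <;> rfl

/-- A side differs from its opposite. [folklore] -/
private theorem Side.opp_ne_self (s : Side) : s.opp ≠ s := by cases s <;> decide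

/-- A straight arc drawn on two sides of `w` joins a side to its opposite: `IsWE`/`IsSN` force
`v = u.opp`. [folklore] -/
private theorem eq_opp_of_isWE_or_isSN {f w : Face} {u v : Side}
    (h : IsWE f (w.side u, w.side v) ∨ IsSN f (w.side u, w.side v)) : v = u.opp := by
  have key : ∀ X Y : Side, X ≠ Y → Y = X.opp → (w.side u, w.side v) = (f.side X, f.side Y) → v = u.opp := by
    intro X Y hXY hYX e
    have h1 := (Prod.mk.inj e).1
    have h2 := (Prod.mk.inj e).2
    by_cases huv : u = v
    · subst huv; exact absurd (Face.side_injective f (h1.symm.trans h2)) hXY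
    · have ha := arcFace_side_side w u v huv
      rw [h1, h2, arcFace_side_side f X Y hXY] at ha
      have hfw : f = w := Option.some_injective _ ha
      subst hfw
      rw [Face.side_injective f h1, Face.side_injective f h2, hYX]
  rcases h with (e | e) | (e | e)
  · exact key .W .E (by decide) rfl e
  · exact key .E .W (by decide) rfl e
  · exact key .S .N (by decide) rfl e
  · exact key .N .S (by decide) rfl e

/-- The index function of the sandwich walk: root, the middle walk, the opposite side. [folklore] -/
def sandFn (a e : MidEdge) {D : Set Face} {b c : MidEdge} (δ : YBWalk D b c) : ℕ → MidEdge
  | 0 => a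
  | j + 1 => if j ≤ δ.arcs.length then δ.nth j else e

/-- A middle walk between opposite lateral sides has at least one arc. [folklore] -/
private theorem arcs_pos_of_lateral {s : Side} (δ : YBWalk (dom (eraseFace Dl w)) (w.side s) (w.side s.opp)) :
    0 < δ.arcs.length := by
  by_contra h0
  have e := δ.nth_length
  rw [show δ.arcs.length = 0 by omega, δ.nth_zero] at e
  exact Side.opp_ne_self s (Face.side_injective w e).symm

/-- **The sandwich walk**: root arc `σ → s` in `w`, a walk of `D ∖ {w}` from `w.side s` to the opposite
lateral side, and the closing arc `s.opp → σ.opp` in `w` into the opposite side. [folklore] -/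
def snocWalk (hw : w ∈ Dl) (hh : nbr w σ ∉ dom Dl) (ho : nbr w σ.opp ∉ dom Dl) {s : Side} (hs : s ≠ σ)
    (hso : s ≠ σ.opp) (δ : YBWalk (dom (eraseFace Dl w)) (w.side s) (w.side s.opp)) :
    YBWalk (dom Dl) (w.side σ) (w.side σ.opp) := by
  have hm := arcs_pos_of_lateral δ
  have hso' : s.opp ≠ σ.opp := fun e => hs (by rw [← Side.opp_opp s, e, Side.opp_opp])
  have hsos : s.opp ≠ σ := fun e => hso (by rw [← e, Side.opp_opp])
  -- values of the index function
  have v0 : sandFn (w.side σ) (w.side σ.opp) δ 0 = w.side σ := rfl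
  have vmid : ∀ j ≤ δ.arcs.length, sandFn (w.side σ) (w.side σ.opp) δ (j + 1) = δ.nth j :=
    fun j hj => if_pos hj
  have vlast : sandFn (w.side σ) (w.side σ.opp) δ (δ.arcs.length + 2) = w.side σ.opp :=
    if_neg (by omega)
  have hfirst : arcFace (w.side σ, δ.nth 0) = some w := by rw [δ.nth_zero]; exact arcFace_side_side w σ s hs.symm
  have hlast : arcFace (δ.nth δ.arcs.length, w.side σ.opp) = some w := by
    rw [δ.nth_length]; exact arcFace_side_side w s.opp σ.opp hso'
  have hne_root : ∀ i ≤ δ.arcs.length, δ.nth i ≠ w.side σ := fun i hi => nth_ne_root hh hs δ hi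
  have hne_opp : ∀ i ≤ δ.arcs.length, δ.nth i ≠ w.side σ.opp := fun i hi => nth_ne_root (σ := σ.opp) ho hso δ hi
  refine (YBWalk.ofFn (D := dom Dl) (δ.arcs.length + 2) (sandFn (w.side σ) (w.side σ.opp) δ) ?_ ?_ ?_ ?_).cast v0 vlast
  · -- injective
    intro i j hi hj h
    rcases i with _ | i <;> rcases j with _ | j
    · rfl
    · exfalso
      rcases Nat.lt_or_ge j (δ.arcs.length + 1) with hj' | hj'
      · rw [v0, vmid j (by omega)] at h; exact hne_root j (by omega) h.symm
      · rw [v0, show j + 1 = δ.arcs.length + 2 from by omega, vlast] at h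
        exact Side.opp_ne_self σ (Face.side_injective w h).symm
    · exfalso
      rcases Nat.lt_or_ge i (δ.arcs.length + 1) with hi' | hi'
      · rw [v0, vmid i (by omega)] at h; exact hne_root i (by omega) h
      · rw [v0, show i + 1 = δ.arcs.length + 2 from by omega, vlast] at h
        exact Side.opp_ne_self σ (Face.side_injective w h)
    · rcases Nat.lt_or_ge i (δ.arcs.length + 1) with hi' | hi' <;> rcases Nat.lt_or_ge j (δ.arcs.length + 1) with hj' | hj'
      · rw [vmid i (by omega), vmid j (by omega)] at h; have := δ.nth_inj (by omega) (by omega) h; omega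
      · rw [vmid i (by omega), show j + 1 = δ.arcs.length + 2 from by omega, vlast] at h
        exact absurd h (hne_opp i (by omega))
      · rw [vmid j (by omega), show i + 1 = δ.arcs.length + 2 from by omega, vlast] at h
        exact absurd h.symm (hne_opp j (by omega))
      · omega
  · -- arcs in the domain
    intro i hi
    rcases i with _ | i
    · exact ⟨w, hw, by rw [v0, vmid 0 (by omega)]; exact hfirst⟩
    · rcases Nat.lt_or_ge i δ.arcs.length with hi' | hi'
      · obtain ⟨f, hfD, hf⟩ := δ.arc_nth hi'
        exact ⟨f, dom_eraseFace_subset _ _ hfD, by rw [vmid i (by omega), vmid (i + 1) (by omega)]; exact hf⟩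
      · have ei : i = δ.arcs.length := by omega
        subst ei
        exact ⟨w, hw, by rw [vmid _ le_rfl, vlast]; exact hlast⟩
  · -- consecutive arcs in different plaquettes
    intro i hi
    rcases i with _ | i
    · rw [v0, vmid 0 (by omega), vmid 1 (by omega), hfirst]
      obtain ⟨f, hfD, hf⟩ := δ.arc_nth (i := 0) hm
      rw [hf]; exact fun e => (mem_eraseFace.1 hfD).2 (Option.some_injective _ e).symm
    · rcases Nat.lt_or_ge (i + 1) δ.arcs.length with hi' | hi'
      · rw [vmid i (by omega), vmid (i + 1) (by omega), vmid (i + 2) (by omega)]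
        exact δ.chain_nth hi'
      · have ei : i + 1 = δ.arcs.length := by omega
        rw [vmid i (by omega), vmid (i + 1) (by omega), show i + 1 + 2 = δ.arcs.length + 2 from by omega, vlast]
        obtain ⟨f, hfD, hf⟩ := δ.arc_nth (i := i) (by omega)
        rw [hf, ei, hlast]
        exact fun e => (mem_eraseFace.1 hfD).2 (Option.some_injective _ e)
  · -- no two crossing straight arcs: the arcs of `w` are corner arcs, the others avoid `w`
    intro i j hi hj f hWE hSN
    -- classify an index: its arc is in `w` (i = 0 or i = last) or it is an arc of δ
    have harc : ∀ i < δ.arcs.length + 2,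
        (sandFn (w.side σ) (w.side σ.opp) δ i, sandFn (w.side σ) (w.side σ.opp) δ (i + 1)) = (w.side σ, w.side s) ∨
        (sandFn (w.side σ) (w.side σ.opp) δ i, sandFn (w.side σ) (w.side σ.opp) δ (i + 1)) = (w.side s.opp, w.side σ.opp) ∨
        ∃ j < δ.arcs.length, (sandFn (w.side σ) (w.side σ.opp) δ i, sandFn (w.side σ) (w.side σ.opp) δ (i + 1)) =
          (δ.nth j, δ.nth (j + 1)) := by
      intro i hi
      rcases i with _ | i
      · left; rw [v0, vmid 0 (by omega), δ.nth_zero]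
      · rcases Nat.lt_or_ge i δ.arcs.length with hi' | hi'
        · right; right; exact ⟨i, hi', by rw [vmid i (by omega), vmid (i + 1) (by omega)]⟩
        · right; left
          have ei : i = δ.arcs.length := by omega
          subst ei; rw [vmid _ le_rfl, vlast, δ.nth_length]
    have hw_of_δ : ∀ j < δ.arcs.length, ∀ g, arcFace (δ.nth j, δ.nth (j + 1)) = some g → g ≠ w := by
      intro j hj g hg e; subst e
      obtain ⟨f, hfD, hf⟩ := δ.arc_nth hj
      exact arcFace_ne_of_mem_erase hfD hf hg
    rcases harc i hi with ei | ei | ⟨i', hi', ei⟩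
    · rw [ei] at hWE; exact hso (eq_opp_of_isWE_or_isSN (Or.inl hWE))
    · rw [ei] at hWE
      have h := eq_opp_of_isWE_or_isSN (Or.inl hWE)
      rw [Side.opp_opp] at h
      exact hso h.symm
    · rw [ei] at hWE
      have hfw : f ≠ w := hw_of_δ i' hi' f (arcFace_of_isWE hWE)
      rcases harc j hj with ej | ej | ⟨j', hj', ej⟩
      · rw [ej] at hSN
        have := arcFace_of_isSN hSN
        rw [arcFace_side_side w σ s hs.symm] at this
        exact hfw (Option.some_injective _ this).symm
      · rw [ej] at hSN
        have := arcFace_of_isSN hSN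
        rw [arcFace_side_side w s.opp σ.opp hso'] at this
        exact hfw (Option.some_injective _ this).symm
      · rw [ej] at hSN; exact δ.nc_nth hi' hj' f hWE hSN

end Closing

/-! ### The observable at the opposite side of the root plaquette -/

section Opposite

variable {Dl : List Face} {w : Face} {σ : Side} {z : MidEdge}

/-- The mid-edges of the sandwich walk. [folklore] -/
private theorem snocWalk_mids (hw : w ∈ Dl) (hh : nbr w σ ∉ dom Dl) (ho : nbr w σ.opp ∉ dom Dl) {s : Side}
    (hs : s ≠ σ) (hso : s ≠ σ.opp) (δ : YBWalk (dom (eraseFace Dl w)) (w.side s) (w.side s.opp)) :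
    (snocWalk hw hh ho hs hso δ).mids = w.side σ :: (δ.mids ++ [w.side σ.opp]) := by
  rw [snocWalk, YBWalk.cast_mids, YBWalk.ofFn_mids]
  apply List.ext_getElem
  · rw [List.length_ofFn, List.length_cons, List.length_append, List.length_singleton, δ.length_eq]
  · intro i h1 h2
    rw [List.getElem_ofFn]
    rcases i with _ | i
    · rfl
    · rw [List.getElem_cons_succ]
      show (if i ≤ δ.arcs.length then δ.nth i else w.side σ.opp) = _
      rw [List.length_ofFn] at h1
      by_cases hi : i ≤ δ.arcs.length
      · rw [if_pos hi, List.getElem_append_left (by rw [δ.length_eq]; omega), ← δ.nth_eq_getElem]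
      · rw [if_neg hi, List.getElem_append_right (by rw [δ.length_eq]; omega)]
        simp

/-- The sandwich walks are distinct for distinct middles. [folklore] -/
private theorem snocWalk_injective (hw : w ∈ Dl) (hh : nbr w σ ∉ dom Dl) (ho : nbr w σ.opp ∉ dom Dl) {s : Side}
    (hs : s ≠ σ) (hso : s ≠ σ.opp) : Function.Injective (snocWalk hw hh ho hs hso) := by
  intro δ δ' h
  have hm := congrArg YBWalk.mids h
  rw [snocWalk_mids, snocWalk_mids] at hm
  exact YBWalk.ext (List.append_cancel_right (List.cons_injective hm))

/-- Sandwich walks through different first lateral sides differ. [folklore] -/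
private theorem snocWalk_ne (hw : w ∈ Dl) (hh : nbr w σ ∉ dom Dl) (ho : nbr w σ.opp ∉ dom Dl) {s s' : Side}
    (hs : s ≠ σ) (hso : s ≠ σ.opp) (hs' : s' ≠ σ) (hso' : s' ≠ σ.opp) (hss : s ≠ s')
    (δ : YBWalk (dom (eraseFace Dl w)) (w.side s) (w.side s.opp))
    (δ' : YBWalk (dom (eraseFace Dl w)) (w.side s') (w.side s'.opp)) :
    snocWalk hw hh ho hs hso δ ≠ snocWalk hw hh ho hs' hso' δ' := by
  intro h
  have hm := congrArg YBWalk.mids h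
  rw [snocWalk_mids, snocWalk_mids] at hm
  have h1 := List.cons_injective hm
  have h2 : (δ.mids ++ [w.side σ.opp]).head? = (δ'.mids ++ [w.side σ.opp]).head? := by rw [h1]
  rw [List.head?_append, List.head?_append, δ.head_eq, δ'.head_eq] at h2
  exact hss (Face.side_injective w (Option.some_injective _ (by simpa using h2)))

/-- The summand of the observable for a sandwich walk. [cite: GlazmanManolescu2019, §2.1, eq. (2.1)] -/
theorem summand_snocWalk (W : CWeights) {t : ℂ} (ht : t ≠ 0) (hw : w ∈ Dl) (hh : nbr w σ ∉ dom Dl)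
    (ho : nbr w σ.opp ∉ dom Dl) {s : Side} (hs : s ≠ σ) (hso : s ≠ σ.opp)
    (δ : YBWalk (dom (eraseFace Dl w)) (w.side s) (w.side s.opp)) :
    weightL W (snocWalk hw hh ho hs hso δ).mids * t ^ quarterTurnsL (snocWalk hw hh ho hs hso δ).mids =
      pairCoeff W t σ s * (weightL W δ.mids * t ^ quarterTurnsL δ.mids) := by
  rw [snocWalk_mids]
  obtain ⟨hd, tl, e⟩ := List.exists_cons_of_ne_nil δ.mids_ne_nil
  have hhd : hd = w.side s := by
    have h := δ.head_eq; rw [e] at h; exact Option.some_injective _ h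
  have hlast : (hd :: tl).getLast (List.cons_ne_nil _ _) = w.side s.opp := by
    have h := δ.getLast_mids; simp only [e] at h; exact h
  have hso' : s.opp ≠ σ.opp := fun e => hs (by rw [← Side.opp_opp s, e, Side.opp_opp])
  have hw₁ : arcFace (w.side σ, w.side s) = some w := arcFace_side_side w σ s hs.symm
  have hk₁ : arcKindOf (w.side σ, w.side s) = some (arcKind σ s) := arcKindOf_eq hw₁ rfl rfl
  have hw₂ : arcFace (w.side s.opp, w.side σ.opp) = some w := arcFace_side_side w s.opp σ.opp hso'
  have hk₂ : arcKindOf (w.side s.opp, w.side σ.opp) = some (arcKind σ s) := by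
    rw [arcKindOf_eq hw₂ rfl rfl]
    congr 1
    revert hs hso; cases σ <;> cases s <;> decide
  have hkind : arcKind σ s = .corner ∨ arcKind σ s = .coCorner := by
    revert hs hso; cases σ <;> cases s <;> decide
  have hA : ∀ p ∈ arcsOf δ.mids, arcFace p ≠ some w := fun p hp => by
    obtain ⟨f, hfD, hf⟩ := δ.arc_mem p hp
    exact arcFace_ne_of_mem_erase hfD hf
  have hq₁ : qTurnOf (w.side σ, w.side s) = qTurn σ s := by
    unfold qTurnOf; rw [hw₁]; simp [Face.sideOf_side]
  have hq₂ : qTurnOf (w.side s.opp, w.side σ.opp) = qTurn s.opp σ.opp := by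
    unfold qTurnOf; rw [hw₂]; simp [Face.sideOf_side]
  rw [e] at hA ⊢
  rw [hhd] at hA hlast ⊢
  rw [weightL_sandwich W hw₁ hk₁ (hlast ▸ hw₂) (hlast ▸ hk₂) hA hkind, quarterTurnsL_sandwich, hlast, hq₁, hq₂]
  simp only [pairCoeff, zpow_add₀ ht]
  ring

/-- The mid-edges of a walk: all but the last, then the last. [folklore] -/
private theorem mids_eq_dropLast_append (γ : YBWalk (dom Dl) (w.side σ) z) (hn : 0 < γ.arcs.length) :
    γ.mids = (γ.dropLast hn).mids ++ [z] := by
  have hdl : (γ.dropLast hn).mids.length = γ.arcs.length := by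
    rw [YBWalk.length_eq, YBWalk.dropLast_length]; omega
  apply List.ext_getElem
  · rw [List.length_append, List.length_singleton, hdl, γ.length_eq]
  · intro i h1 h2
    rw [γ.length_eq] at h1
    by_cases hi : i < γ.arcs.length
    · rw [List.getElem_append_left (by omega), ← γ.nth_eq_getElem, ← YBWalk.nth_eq_getElem,
        YBWalk.dropLast_nth _ _ (by omega)]
    · have ei : i = γ.arcs.length := by omega
      subst ei
      rw [List.getElem_append_right (by omega), ← γ.nth_eq_getElem, γ.nth_length]
      simp [hdl]

/-- Two lateral sides that differ are opposite. [folklore] -/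
private theorem eq_opp_of_laterals {σ s s' : Side} (hs : s ≠ σ) (hso : s ≠ σ.opp) (hs' : s' ≠ σ)
    (hs'o : s' ≠ σ.opp) (hss : s ≠ s') : s' = s.opp := by
  revert s s' σ; decide

/-- **Covering at the opposite side**: a walk from the isthmus root to the opposite side of `w` is
either the one-arc walk or a sandwich walk. [folklore] -/
private theorem exists_snocWalk (hw : w ∈ Dl) (hh : nbr w σ ∉ dom Dl) (ho : nbr w σ.opp ∉ dom Dl)
    (γ : YBWalk (dom Dl) (w.side σ) (w.side σ.opp)) :
    γ.mids = [w.side σ, w.side σ.opp] ∨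
      ∃ (s : Side) (hs : s ≠ σ) (hso : s ≠ σ.opp) (δ : YBWalk (dom (eraseFace Dl w)) (w.side s) (w.side s.opp)),
        (snocWalk hw hh ho hs hso δ).mids = γ.mids := by
  have hn : 0 < γ.arcs.length := by
    by_contra h
    have e := γ.nth_length
    rw [show γ.arcs.length = 0 by omega, γ.nth_zero] at e
    exact Side.opp_ne_self σ (Face.side_injective w e).symm
  rcases Nat.lt_or_ge 1 γ.arcs.length with h2 | h1
  · right
    -- the last arc lies in `w`, from a lateral side `s'`
    obtain ⟨f, hfD, hf⟩ := γ.arc_nth (i := γ.arcs.length - 1) (by omega)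
    rw [show γ.arcs.length - 1 + 1 = γ.arcs.length from by omega, γ.nth_length] at hf
    have hfw : f = w := by
      rcases arcFace_right_cases hf with h | h
      · exact h
      · exact absurd (h ▸ hfD) ho
    subst hfw
    obtain ⟨s', t', hst, hs'e, ht'e, -⟩ := exists_sides_of_arcFace hf
    simp only at hs'e ht'e
    have ht' : t' = σ.opp := Face.side_injective f ht'e
    have hs'σ : s' ≠ σ := by
      intro e; rw [e] at hs'e
      have := γ.nth_inj (i := γ.arcs.length - 1) (j := 0) (by omega) (Nat.zero_le _) (hs'e.symm.trans γ.nth_zero.symm)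
      omega
    have hs'o : s' ≠ σ.opp := fun e => hst (e.trans ht'.symm)
    -- the walk without its last arc ends at the lateral side `s'`; decompose it at the root
    let γ' : YBWalk (dom Dl) (f.side σ) (f.side s') := (γ.dropLast hn).cast rfl hs'e.symm
    have hγ'm : γ'.mids = (γ.dropLast hn).mids := YBWalk.cast_mids _ _ _
    obtain ⟨s, hs, δ, hm⟩ := exists_consWalk hw hh ho (z := f.side s')
      (fun e => hs'o (Face.side_injective f e)) (fun e => hs'σ (Face.side_injective f e)) γ'
    have hmids : γ.mids = f.side σ :: (δ.mids ++ [f.side σ.opp]) := by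
      rw [mids_eq_dropLast_append γ hn, ← hγ'm, ← hm, consWalk_mids, List.cons_append]
    obtain ⟨hd, tl, e⟩ := List.exists_cons_of_ne_nil δ.mids_ne_nil
    have hhd : hd = f.side s := by
      have h := δ.head_eq; rw [e] at h; exact Option.some_injective _ h
    have hn1 : γ.nth 1 = f.side s := by
      rw [γ.nth_eq_getElem (by rw [γ.length_eq]; omega)]
      simp [hmids, e, hhd]
    have hso : s ≠ σ.opp := by
      intro hx
      have := γ.nth_inj (i := 1) (j := γ.arcs.length) (by omega) le_rfl (by rw [hn1, γ.nth_length, hx])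
      omega
    have hss : s ≠ s' := by
      intro hx
      subst hx
      -- then `δ` is trivial and the first two arcs of `γ` both lie in `w`
      have hδ : δ.mids = [f.side s] := mids_eq_singleton_of_end_eq δ
      have hγ3 : γ.mids = [f.side σ, f.side s, f.side σ.opp] := by rw [hmids, hδ]; rfl
      have hlen : γ.arcs.length = 2 := by have := γ.length_eq; rw [hγ3] at this; simp at this; omega
      have e0 : γ.nth 0 = f.side σ := γ.nth_zero
      have e2 : γ.nth 2 = f.side σ.opp := by rw [← hlen]; exact γ.nth_length
      have hc := γ.chain_nth (i := 0) (by omega)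
      rw [e0, zero_add, hn1, e2, arcFace_side_side f σ s hs.symm, arcFace_side_side f s σ.opp hso] at hc
      exact hc rfl
    have hs's : s' = s.opp := eq_opp_of_laterals hs hso hs'σ hs'o hss
    subst hs's
    refine ⟨s, hs, hso, δ, ?_⟩
    rw [snocWalk_mids, hmids]
  · left
    have hlen : γ.arcs.length = 1 := by omega
    have hl : γ.mids.length = 2 := by rw [γ.length_eq, hlen]
    have e0 : γ.nth 0 = w.side σ := γ.nth_zero
    have e1 : γ.nth 1 = w.side σ.opp := by rw [← hlen]; exact γ.nth_length
    apply List.ext_getElem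
    · rw [hl]; rfl
    · intro i h1' h2'
      rcases i with _ | _ | i
      · rw [← γ.nth_eq_getElem, e0]; rfl
      · rw [← γ.nth_eq_getElem, e1]; rfl
      · simp at h2'

end Opposite

/-! ### Lateral sides, isolated mid-edges, and the decomposition at the opposite side -/

section Assembly

variable {Dl : List Face} {w : Face} {σ : Side} {z : MidEdge}

/-- A lateral side of the root side `σ` (the other lateral side is its opposite). [folklore] -/
def lat : Side → Side
  | .N => .W
  | .S => .W
  | .W => .S
  | .E => .S

/-- The four sides seen from `σ`: itself, its opposite, the lateral side and its opposite are pairwise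
distinct. [folklore] -/
private theorem lat_facts (σ : Side) :
    lat σ ≠ σ ∧ lat σ ≠ σ.opp ∧ (lat σ).opp ≠ σ ∧ (lat σ).opp ≠ σ.opp ∧ (lat σ).opp ≠ lat σ ∧ σ.opp ≠ σ := by
  cases σ <;> decide

/-- Sums over the four sides, arranged around `σ`. [folklore] -/
private theorem sum_side (σ : Side) (g : Side → ℂ) : ∑ u : Side, g u = g σ + g σ.opp + g (lat σ) + g (lat σ).opp := by
  cases σ <;>
  · rw [show (Finset.univ : Finset Side) = {Side.W, Side.E, Side.S, Side.N} from by decide,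
      Finset.sum_insert (by decide), Finset.sum_insert (by decide), Finset.sum_insert (by decide), Finset.sum_singleton]
    simp only [lat, Side.opp]; ring

/-- Sums over the three sides other than `σ`. [folklore] -/
private theorem sum_erase (σ : Side) (g : Side → ℂ) :
    ∑ u ∈ Finset.univ.erase σ, g u = g σ.opp + g (lat σ) + g (lat σ).opp := by
  cases σ
  · rw [show (Finset.univ.erase Side.W : Finset Side) = {Side.E, Side.S, Side.N} from by decide]
    rw [Finset.sum_insert (by decide), Finset.sum_insert (by decide), Finset.sum_singleton]
    simp only [lat, Side.opp]; ring
  · rw [show (Finset.univ.erase Side.E : Finset Side) = {Side.W, Side.S, Side.N} from by decide]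
    rw [Finset.sum_insert (by decide), Finset.sum_insert (by decide), Finset.sum_singleton]
    simp only [lat, Side.opp]; ring
  · rw [show (Finset.univ.erase Side.S : Finset Side) = {Side.N, Side.W, Side.E} from by decide]
    rw [Finset.sum_insert (by decide), Finset.sum_insert (by decide), Finset.sum_singleton]
    simp only [lat, Side.opp]; ring
  · rw [show (Finset.univ.erase Side.N : Finset Side) = {Side.S, Side.W, Side.E} from by decide]
    rw [Finset.sum_insert (by decide), Finset.sum_insert (by decide), Finset.sum_singleton]
    simp only [lat, Side.opp]; ring

/-- Sums over the two lateral sides. [folklore] -/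
private theorem sum_lat (σ : Side) (g : Side → ℂ) :
    ∑ u ∈ (Finset.univ.erase σ).erase σ.opp, g u = g (lat σ) + g (lat σ).opp := by
  cases σ
  · rw [show ((Finset.univ.erase Side.W).erase (Side.opp .W) : Finset Side) = {Side.S, Side.N} from by decide,
      Finset.sum_pair (by decide)]; rfl
  · rw [show ((Finset.univ.erase Side.E).erase (Side.opp .E) : Finset Side) = {Side.S, Side.N} from by decide,
      Finset.sum_pair (by decide)]; rfl
  · rw [show ((Finset.univ.erase Side.S).erase (Side.opp .S) : Finset Side) = {Side.W, Side.E} from by decide,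
      Finset.sum_pair (by decide)]; rfl
  · rw [show ((Finset.univ.erase Side.N).erase (Side.opp .N) : Finset Side) = {Side.W, Side.E} from by decide,
      Finset.sum_pair (by decide)]; rfl

/-- **No walk leaves an isolated mid-edge**: if neither plaquette of `x` is in the domain, the
observable from `x` vanishes away from `x`. [cite: GlazmanManolescu2019, §2.1, eq. (2.1)] -/
theorem gmObservable_eq_zero_of_isolated (W : CWeights) (t : ℂ) (L : List Face) {x y : MidEdge}
    (h1 : x.faces.1 ∉ dom L) (h2 : x.faces.2 ∉ dom L) (hxy : y ≠ x) : gmObservable W t L x y = 0 := by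
  haveI : IsEmpty (YBWalk (dom L) x y) := ⟨fun γ => by
    rcases Nat.eq_zero_or_pos γ.arcs.length with h0 | hpos
    · have e := γ.nth_length; rw [h0, γ.nth_zero] at e; exact hxy e.symm
    · obtain ⟨f, hfD, hf⟩ := γ.arc_nth hpos
      rw [γ.nth_zero] at hf
      rcases (MidEdge.commonFace_eq_some hf).2.1 with e | e
      · exact h1 (e ▸ hfD)
      · exact h2 (e ▸ hfD)⟩
  unfold gmObservable
  simp

/-- The opposite side of the root is isolated in `D ∖ {w}`. [folklore] -/
private theorem gmObservable_erase_opp (W : CWeights) (t : ℂ) (ho : nbr w σ.opp ∉ dom Dl) {y : MidEdge}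
    (hy : y ≠ w.side σ.opp) : gmObservable W t (eraseFace Dl w) (w.side σ.opp) y = 0 := by
  have hw' : w ∉ dom (eraseFace Dl w) := fun h => (mem_eraseFace.1 h).2 rfl
  have ho' : nbr w σ.opp ∉ dom (eraseFace Dl w) := fun h => ho (dom_eraseFace_subset _ _ h)
  refine gmObservable_eq_zero_of_isolated W t _ ?_ ?_ hy <;>
    rcases faces_side_eq w σ.opp with e | e <;> simp only [e] <;> assumption

/-- In the empty domain the observable vanishes away from the root. [folklore] -/
private theorem gmObservable_nil (W : CWeights) (t : ℂ) {x y : MidEdge} (hxy : y ≠ x) : gmObservable W t [] x y = 0 :=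
  gmObservable_eq_zero_of_isolated W t [] (fun h => by simp [dom] at h) (fun h => by simp [dom] at h) hxy

/-- Removing `w` from `[w]` leaves the empty list. [folklore] -/
private theorem eraseFace_single (w : Face) : eraseFace [w] w = [] := by simp [eraseFace]

/-- The plaquette lattice weight of a one-element list is one. [folklore] -/
private theorem summand_singleton (W : CWeights) (t : ℂ) (x : MidEdge) :
    weightL W [x] * t ^ quarterTurnsL [x] = 1 := by
  simp [weightL, cfgCount, facesL, quarterTurnsL, arcsOf, CWeights.mono]

/-- **Decomposition of the observable at the opposite side of the root plaquette**: the one-arc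
(straight) walk plus, for each lateral side `s`, the sandwich walks through `D ∖ {w}` from `w.side s`
to `w.side s.opp`. [cite: GlazmanManolescu2019, §2.1, eq. (2.1) (the observable as a sum over walks)] -/
theorem gmObservable_isthmus_opp (W : CWeights) {t : ℂ} (ht : t ≠ 0) (hw : w ∈ Dl) (hh : nbr w σ ∉ dom Dl)
    (ho : nbr w σ.opp ∉ dom Dl) :
    gmObservable W t Dl (w.side σ) (w.side σ.opp) = rootCoeff W t σ σ.opp +
      ∑ s ∈ (Finset.univ.erase σ).erase σ.opp,
        pairCoeff W t σ s * gmObservable W t (eraseFace Dl w) (w.side s) (w.side s.opp) := by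
  classical
  have hoσ : σ.opp ≠ σ := (lat_facts σ).2.2.2.2.2
  -- the one-arc walk
  let one : YBWalk (dom Dl) (w.side σ) (w.side σ.opp) := consWalk hw hh hoσ (YBWalk.trivial (w.side σ.opp))
  have hone : one.mids = [w.side σ, w.side σ.opp] := by
    show (consWalk hw hh hoσ (YBWalk.trivial (w.side σ.opp))).mids = _
    rw [consWalk_mids, mids_eq_singleton_of_end_eq]
  -- the sandwich images
  let I : Side → Finset (YBWalk (dom Dl) (w.side σ) (w.side σ.opp)) :=
    fun s => if h : s ≠ σ ∧ s ≠ σ.opp then Finset.univ.image (snocWalk hw hh ho h.1 h.2) else ∅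
  have hIs : ∀ {s : Side} (hs : s ≠ σ) (hso : s ≠ σ.opp), I s = Finset.univ.image (snocWalk hw hh ho hs hso) :=
    fun hs hso => dif_pos ⟨hs, hso⟩
  have hmemL : ∀ {s : Side}, s ∈ (Finset.univ.erase σ).erase σ.opp ↔ s ≠ σ ∧ s ≠ σ.opp := by
    intro s; simp [Finset.mem_erase, and_comm]
  have hcover : (Finset.univ : Finset (YBWalk (dom Dl) (w.side σ) (w.side σ.opp))) =
      {one} ∪ ((Finset.univ.erase σ).erase σ.opp).biUnion I := by
    ext γ
    simp only [Finset.mem_univ, Finset.mem_union, Finset.mem_singleton, Finset.mem_biUnion, true_iff]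
    rcases exists_snocWalk hw hh ho γ with hm | ⟨s, hs, hso, δ, hm⟩
    · left; exact YBWalk.ext (hm.trans hone.symm)
    · right
      refine ⟨s, hmemL.2 ⟨hs, hso⟩, ?_⟩
      rw [hIs hs hso]
      exact Finset.mem_image.2 ⟨δ, Finset.mem_univ _, YBWalk.ext hm⟩
  have hdisj1 : Disjoint ({one} : Finset _) (((Finset.univ.erase σ).erase σ.opp).biUnion I) := by
    rw [Finset.disjoint_singleton_left, Finset.mem_biUnion]
    rintro ⟨s, hs, hmem⟩
    obtain ⟨hs1, hs2⟩ := hmemL.1 hs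
    rw [hIs hs1 hs2] at hmem
    obtain ⟨δ, -, hδ⟩ := Finset.mem_image.1 hmem
    have hl := congrArg (fun γ : YBWalk (dom Dl) (w.side σ) (w.side σ.opp) => γ.mids.length) hδ
    simp only [snocWalk_mids, hone, List.length_cons, List.length_append, δ.length_eq] at hl
    omega
  have hdisj2 : (((Finset.univ.erase σ).erase σ.opp : Finset Side) : Set Side).PairwiseDisjoint I := by
    intro s hs s' hs' hss
    obtain ⟨h1, h1'⟩ := hmemL.1 (Finset.mem_coe.1 hs)
    obtain ⟨h2, h2'⟩ := hmemL.1 (Finset.mem_coe.1 hs')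
    change Disjoint (I s) (I s')
    rw [hIs h1 h1', hIs h2 h2', Finset.disjoint_left]
    intro γ hγ hγ'
    obtain ⟨δ, -, rfl⟩ := Finset.mem_image.1 hγ
    obtain ⟨δ', -, h⟩ := Finset.mem_image.1 hγ'
    exact snocWalk_ne hw hh ho h2 h2' h1 h1' (Ne.symm hss) δ' δ h
  unfold gmObservable
  rw [hcover, Finset.sum_union hdisj1, Finset.sum_singleton, Finset.sum_biUnion hdisj2]
  congr 1
  · rw [hone, ← mids_eq_singleton_of_end_eq (YBWalk.trivial (w.side σ.opp) : YBWalk (dom (eraseFace Dl w)) _ _),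
      ← consWalk_mids hw hh hoσ, summand_consWalk W ht hw hh hoσ, mids_eq_singleton_of_end_eq, summand_singleton,
      mul_one, rootCoeff]
  · refine Finset.sum_congr rfl fun s hs => ?_
    obtain ⟨h1, h2⟩ := hmemL.1 hs
    rw [hIs h1 h2, Finset.sum_image fun δ _ δ' _ h => snocWalk_injective hw hh ho h1 h2 h, Finset.mul_sum]
    refine Finset.sum_congr rfl fun δ _ => ?_
    rw [summand_snocWalk W ht hw hh ho h1 h2 δ]

/-! ### The defect at the root plaquette -/

/-- The slot index of a side in the order `(E, N, W, S)` of `vertexFunctional`. [folklore] -/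
def slotIdx : Side → Fin 4
  | .E => 0
  | .N => 1
  | .W => 2
  | .S => 3

/-- The slot of a side is that side. [folklore] -/
private theorem slotSide_slotIdx (f₀ : Face) (u : Side) : slotSide f₀ (slotIdx u) = f₀.side u := by
  cases u <;> rfl

/-- The vertex functional as a sum over the four sides. [cite: DuminilCopinSmirnov2012, Lemma 1 (shape of the relation)] -/
theorem vertexFunctional_eq_sum_sides (W : CWeights) (t : ℂ) (c : Fin 4 → ℂ) (Dl : List Face) (a : MidEdge)
    (f₀ : Face) : vertexFunctional W t c Dl a f₀ = ∑ u : Side, c (slotIdx u) * gmObservable W t Dl a (f₀.side u) := by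
  unfold vertexFunctional
  rw [Fin.sum_univ_four, show (Finset.univ : Finset Side) = {Side.E, Side.N, Side.W, Side.S} from by decide,
    Finset.sum_insert (by decide), Finset.sum_insert (by decide), Finset.sum_insert (by decide), Finset.sum_singleton]
  have e0 : slotSide f₀ 0 = f₀.side .E := rfl
  have e1 : slotSide f₀ 1 = f₀.side .N := rfl
  have e2 : slotSide f₀ 2 = f₀.side .W := rfl
  have e3 : slotSide f₀ 3 = f₀.side .S := rfl
  rw [e0, e1, e2, e3]
  simp only [slotIdx]
  ring

/-- The coefficient of the defect carried by the walks of `D ∖ {w}` from the lateral side `s` to its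
opposite: ending there (`c_{s.opp} ×` root-arc coefficient) or closing through `w` into the opposite
side of the root (`c_{σ.opp} ×` two-arc coefficient). [cite: GlazmanManolescu2019, Lemma 2.1 (proof: the groups of walks differing inside one rhombus)] -/
def defectCoeff (W : CWeights) (t : ℂ) (c : Fin 4 → ℂ) (σ s : Side) : ℂ :=
  c (slotIdx s.opp) * rootCoeff W t σ s + c (slotIdx σ.opp) * pairCoeff W t σ s

/-- **The defect identity at the root plaquette of an isthmus root** (general weights): the vertex
functional at `w` from the root `w.side σ` equals the functional of the one-plaquette domain `[w]`
plus, for each lateral side `s`, the defect coefficient times the observable of `D ∖ {w}` from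
`w.side s` to `w.side s.opp`. The hole enters ONLY through these two boundary-to-boundary observables
of `D ∖ {w}` across the slot. [cite: GlazmanManolescu2019, Lemma 2.1 (proof: grouping of walks at one rhombus)] -/
theorem vertexFunctional_isthmus_root (W : CWeights) {t : ℂ} (ht : t ≠ 0) (c : Fin 4 → ℂ) (hw : w ∈ Dl)
    (hh : nbr w σ ∉ dom Dl) (ho : nbr w σ.opp ∉ dom Dl) :
    vertexFunctional W t c Dl (w.side σ) w = vertexFunctional W t c [w] (w.side σ) w +
      ∑ s ∈ (Finset.univ.erase σ).erase σ.opp,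
        defectCoeff W t c σ s * gmObservable W t (eraseFace Dl w) (w.side s) (w.side s.opp) := by
  obtain ⟨hl1, hl2, hl3, hl4, hl5, hoσ⟩ := lat_facts σ
  have hne : ∀ {u v : Side}, u ≠ v → w.side u ≠ w.side v := fun huv e => huv (Face.side_injective w e)
  -- hypotheses for the one-plaquette domain
  have hw1 : w ∈ [w] := List.mem_singleton.2 rfl
  have hh1 : nbr w σ ∉ dom [w] := by
    intro h; have h' : nbr w σ = w := List.mem_singleton.1 h
    obtain ⟨x, y⟩ := w; cases σ <;> simp [nbr] at h'
  have ho1 : nbr w σ.opp ∉ dom [w] := by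
    intro h; have h' : nbr w σ.opp = w := List.mem_singleton.1 h
    obtain ⟨x, y⟩ := w; cases σ <;> simp [nbr, Side.opp] at h'
  -- expand both functionals over the four sides around `σ`
  rw [vertexFunctional_eq_sum_sides, vertexFunctional_eq_sum_sides, sum_side σ, sum_side σ, sum_lat σ]
  -- the root side and the opposite side
  rw [gmObservable_root, gmObservable_root, gmObservable_isthmus_opp W ht hw hh ho,
    gmObservable_isthmus_opp W ht hw1 hh1 ho1, sum_lat σ, sum_lat σ]
  simp only [Side.opp_opp, eraseFace_single]
  rw [gmObservable_nil W t (hne hl5), gmObservable_nil W t (hne hl5.symm)]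
  -- the lateral sides
  rw [gmObservable_isthmus W ht hw hh ho (hne hl2) (hne hl1), gmObservable_isthmus W ht hw hh ho (hne hl4) (hne hl3),
    gmObservable_isthmus W ht hw1 hh1 ho1 (hne hl2) (hne hl1), gmObservable_isthmus W ht hw1 hh1 ho1 (hne hl4) (hne hl3)]
  simp only [sum_erase σ, eraseFace_single, gmObservable_root]
  rw [gmObservable_erase_opp W t ho (hne hl2), gmObservable_erase_opp W t ho (hne hl4),
    gmObservable_nil W t (hne hl2), gmObservable_nil W t (hne hl4), gmObservable_nil W t (hne hl5),
    gmObservable_nil W t (hne hl5.symm)]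
  simp only [defectCoeff, Side.opp_opp]
  ring

/-- The root of the one-plaquette domain is an outer root. [cite: GlazmanManolescu2019, §2.1 (walks start on the boundary)] -/
theorem outerRoot_single (w : Face) (σ : Side) : OuterRoot (dom [w]) (w.side σ) := by
  refine ⟨0, fun _ => nbr w σ, ⟨σ.opp, ?_⟩, ?_, fun i hi => absurd hi (Nat.not_lt_zero _), ?_⟩
  · obtain ⟨x, y⟩ := w; cases σ <;> simp [Face.side, nbr, Side.opp]
  · intro i _ h
    have h' : nbr w σ = w := List.mem_singleton.1 h
    obtain ⟨x, y⟩ := w; cases σ <;> simp [nbr] at h'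
  · obtain ⟨x, y⟩ := w
    cases σ
    · exact Or.inl fun f hf => by rw [List.mem_singleton.1 (show f ∈ [((x, y) : Face)] from hf)]; simp [nbr]
    · exact Or.inr (Or.inl fun f hf => by rw [List.mem_singleton.1 (show f ∈ [((x, y) : Face)] from hf)]; simp [nbr])
    · exact Or.inr (Or.inr (Or.inl fun f hf => by rw [List.mem_singleton.1 (show f ∈ [((x, y) : Face)] from hf)]; simp [nbr]))
    · exact Or.inr (Or.inr (Or.inr fun f hf => by rw [List.mem_singleton.1 (show f ∈ [((x, y) : Face)] from hf)]; simp [nbr]))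

/-- **The defect of the printed Yang–Baxter weights at the root plaquette of an isthmus root**: the
one-plaquette functional vanishes (the root of `[w]` is outer), so the vertex functional at `w` IS the
defect sum — two explicit local coefficients times the two boundary-to-boundary observables of
`D ∖ {w}` across the slot. (Numerically nonzero at genuine hole roots: there every walk of `D ∖ {w}`
between the lateral sides goes around the hole — lane numerics, HOME/code/step0/g12/f4cell/.)
[cite: GlazmanManolescu2019, Lemma 2.1 (proof)] [cite: DuminilCopinSmirnov2012, proof of Lemma 1 («we used the fact that a is on the boundary and Ω is simply connected»)] -/
theorem vertexFunctional_printed_isthmus_root {θ : ℝ} (hθ : θ ∈ Set.Icc (π / 3) (2 * π / 3))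
    (Dl : List Face) (w : Face) (σ : Side) (hw : w ∈ Dl) (hh : nbr w σ ∉ dom Dl)
    (hO : OuterRoot (dom Dl) (w.side σ.opp)) :
    vertexFunctional (printedWeights θ) tFiveEighths (ybCoeff θ) Dl (w.side σ) w =
      ∑ s ∈ (Finset.univ.erase σ).erase σ.opp, defectCoeff (printedWeights θ) tFiveEighths (ybCoeff θ) σ s *
        gmObservable (printedWeights θ) tFiveEighths (eraseFace Dl w) (w.side s) (w.side s.opp) := by
  rw [vertexFunctional_isthmus_root _ tFiveEighths_ne_zero _ hw hh (nbr_opp_not_mem hw hO),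
    vertexFunctional_printed_eq_zero hθ [w] (w.side σ) (outerRoot_single w σ) w (List.mem_singleton.2 rfl), zero_add]

end Assembly

end Literature.Barriers.CriticalPhenomena.PlaquetteWalk
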